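import Literature.NumberTheory.Sieve.PolynomialCongruencesTypeIFromWeyl
import Literature.NumberTheory.Sieve.PolynomialCongruencesProofs
import HarnessLib

/-!
# Type-I information for a quadratic, uniformly in the progression modulus, from class bounds
# for the root Weyl sums of the dilates `Q²X² − Δ`

Topic `Literature/NumberTheory/Sieve` (polynomial congruences; companion of
`PolynomialCongruencesTypeIFromWeyl.lean`).  Let `g = aX² + bX + c₀ ∈ ℤ[X]` be irreducible,
`Δ = b² − 4ac₀`.  The tree's PROVED `TypeIFromWeyl.typeI_of_weylLevelBound` turns a level Weyl-sum
bound for the roots of `g(qX + b₁)` to the moduli prime to a bad modulus into the "type-I"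
information `|∑_{N₁<n≤N₂, ℓ∣n, (n,Q)=1} (#{y<t≤2y : t ≡ b₀ (q), n ∣ g(t)} − (y/q)ρ_g(n)/n)| ≤ K y^{1−ε}`
consumed by cofactor sieves — for ONE fixed progression modulus `q` (its `K, y₀` come after
`∀ q`).  This file PROVES the version UNIFORM in `q` (`typeI_of_weylLevelBound_uniform`: the
constant is `9C_ρ + 1872·2^C·K_W`, linear in the Weyl constant, so a Weyl constant `K_w q^{A_q}`
gives `K q^{A_q} y^{1−ε}` with `K, y₀` independent of `q`), and PROVES the required level Weyl
bound, with constant polynomial in `q`, from a CLASS BOUND for the root Weyl sums of the dilates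
`F_Q = Q²X² − Δ` (`weylLevelBound_uniform`):

  `|∑_{m ≤ M, m ≡ u (Q), (m, Q) = 1} S_{F_Q}(h; m)| ≤ K Q^A |h|^A M^{1−η}`  (all `Q ≥ 1`, `u`, `h ≠ 0`, `M`),

a Hooley-1963-type power saving with polynomial losses (for `Q = 1` this is Hooley's theorem on
`X² − Δ`; the class condition is what the reduction below produces).  The reduction
(`weylSum_mul_eq`): for `n = e n'` with `(n', T) = 1`, `T = q|2aΔ|e`, twisted multiplicativity
(`polyRootWeylSum_mul_of_coprime`, Hooley's Lemma 1), completing the square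
(`weylSumZMod_comp_eq`: modulo `n'` the roots of `g(qX + b₁)` are the affine images
`(Tm − L)(2aq)⁻¹` of the roots `m` of `T²X² − Δ`, `L = 2ab₁ + b`) and the reciprocity
`e(−cT̄/n') = e(c n̄'/T)·e(−c/(Tn'))` (`exp_neg_mul_inv_eq`) give
`S_{g(qX+b₁)}(h; e n') = Λ(n' mod T)·e(−c/(Tn'))·S_{T²X²−Δ}(±hΔ; n')` with `|Λ| ≤ e`; one sums
`n'` in classes modulo `T` with Abel summation against the flat phase (`norm_sum_fiber_le`).  The
level condition `L ∣ n` is carried by the unique factorisation `n = e n'`, `e = gcd(n, Lⁿ)` the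
`L`-part (`factorization_gcd_pow`, `sum_fiber_gcd_pow_eq`): small `e ≤ x^κ` by the fibre bound
(`norm_sum_small_fiber_le`), large `e` trivially (`ρ(en') = ρ(e)ρ(n')`, `ρ_g(e) ≤ C 2^{ω(e)}` —
Hooley's Lemma 4 `exists_polyRootCountMod_le_mul_pow_card_primeFactors` — and
`∑_{n'} ρ(n') ≪ x/e`, `TypeIFromWeyl.exists_sum_card_roots_le`) with Rankin's trick over the
`L`-factored numbers (`sum_rpow_neg_half_le`: `∑ e^{−1/2} ≤ ∏_{p∣L}(1 − p^{−1/2})⁻¹ ≤ L²`).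

Everything here is PROVED; no named fact is introduced (the class bound is a HYPOTHESIS).

## References

* C. Hooley, *On the greatest prime factor of a quadratic polynomial*, Acta Math. 117 (1967)
  281–299, §§3–6 (the type-I method, for `n² − D`). [cite: Hooley1967, §§3–6]
* C. Hooley, *Applications of sieve methods to the theory of numbers*, Cambridge Tracts 70
  (1976), Ch. 2 §§3–6. [cite: Hooley1976, Ch. 2 §§3–6]
* C. Hooley, Mathematika 11 (1964) 39–49, Lemma 1 (twisted multiplicativity) and Lemma 4
  (`ρ(k) ≤ C d^{ω(k)}`), per [cite: MartinSitar2010, §3.2].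
* H. L. Montgomery, R. C. Vaughan, *Multiplicative Number Theory I*, §7.1 (Rankin's method).
  [cite: MontgomeryVaughan2007, §7.1 eq. (7.17)]
-/

noncomputable section

open Polynomial Filter Finset
open scoped BigOperators FourierTransform

namespace Literature.NumberTheory.Sieve

namespace TypeIUniform

/-! ### The `ℓ`-part of an integer: `gcd(n, ℓⁿ)` -/

/-- **The factorization of the `ℓ`-part** `gcd(n, ℓⁿ)`: `v_p = v_p(n)` for `p ∣ ℓ` and `0`
otherwise (for `n ≥ 1`, `v_p(n) < n ≤ n·v_p(ℓ)` when `p ∣ ℓ ≠ 0`; the degenerate cases `n = 0`,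
`ℓ = 0` hold too). [folklore] -/
theorem factorization_gcd_pow (ℓ n p : ℕ) :
    (Nat.gcd n (ℓ ^ n)).factorization p = if p ∣ ℓ then n.factorization p else 0 := by
  rcases Nat.eq_zero_or_pos n with rfl | hn
  · simp
  rcases Nat.eq_zero_or_pos ℓ with rfl | hℓ
  · rw [zero_pow hn.ne', Nat.gcd_zero_right, if_pos (dvd_zero p)]
  rw [Nat.factorization_gcd hn.ne' (pow_ne_zero _ hℓ.ne'), Finsupp.inf_apply, Nat.factorization_pow,
    Finsupp.smul_apply, smul_eq_mul]
  by_cases hp : p.Prime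
  · split_ifs with hpl
    · refine min_eq_left ?_
      have h1 : 1 ≤ ℓ.factorization p := hp.factorization_pos_of_dvd hℓ.ne' hpl
      have h2 : n.factorization p < n := Nat.factorization_lt p hn.ne'
      nlinarith
    · rw [Nat.factorization_eq_zero_of_not_dvd hpl, mul_zero]
      exact min_eq_right (Nat.zero_le _)
  · simp [Nat.factorization_eq_zero_of_not_prime _ hp]

/-- `gcd(n, ℓⁿ) ≠ 0`. [folklore] -/
theorem gcd_pow_ne_zero (ℓ n : ℕ) : Nat.gcd n (ℓ ^ n) ≠ 0 := by
  rcases Nat.eq_zero_or_pos n with rfl | hn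
  · simp
  · exact (Nat.gcd_pos_of_pos_left _ hn).ne'

/-- Every prime factor of `gcd(n, ℓⁿ)` divides `ℓ`. [folklore] -/
theorem dvd_of_prime_dvd_gcd_pow {ℓ n p : ℕ} (hp : p.Prime) (hpd : p ∣ Nat.gcd n (ℓ ^ n)) :
    p ∣ ℓ := by
  by_contra hpB
  have h1 : 1 ≤ (Nat.gcd n (ℓ ^ n)).factorization p :=
    hp.factorization_pos_of_dvd (gcd_pow_ne_zero ℓ n) hpd
  rw [factorization_gcd_pow, if_neg hpB] at h1
  exact Nat.not_succ_le_zero 0 h1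

/-- The prime factors of `gcd(n, ℓⁿ)` are among those of `ℓ` (`ℓ ≠ 0`). [folklore] -/
theorem primeFactors_gcd_pow_subset {ℓ : ℕ} (hℓ : ℓ ≠ 0) (n : ℕ) :
    (Nat.gcd n (ℓ ^ n)).primeFactors ⊆ ℓ.primeFactors := by
  intro p hp
  have hpp := Nat.prime_of_mem_primeFactors hp
  exact Nat.mem_primeFactors.mpr ⟨hpp, dvd_of_prime_dvd_gcd_pow hpp (Nat.dvd_of_mem_primeFactors hp), hℓ⟩

/-- `ℓ ∣ gcd(n, ℓⁿ)` when `ℓ ∣ n ≠ 0`. [folklore] -/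
theorem dvd_gcd_pow {ℓ n : ℕ} (hn : n ≠ 0) (hℓn : ℓ ∣ n) : ℓ ∣ Nat.gcd n (ℓ ^ n) :=
  Nat.dvd_gcd hℓn (dvd_pow_self ℓ hn)

/-- No prime divisor of `ℓ` divides the cofactor `n / gcd(n, ℓⁿ)` (`n ≠ 0`). [folklore] -/
theorem not_dvd_div_gcd_pow {p ℓ n : ℕ} (hp : p.Prime) (hpB : p ∣ ℓ) (hn : n ≠ 0) :
    ¬ p ∣ n / Nat.gcd n (ℓ ^ n) := by
  rw [hp.dvd_iff_one_le_factorization (Nat.div_ne_zero_iff_of_dvd (Nat.gcd_dvd_left _ _)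
    |>.mpr ⟨hn, gcd_pow_ne_zero ℓ n⟩), Nat.factorization_div (Nat.gcd_dvd_left _ _),
    Finsupp.tsub_apply, factorization_gcd_pow, if_pos hpB, Nat.sub_self]
  exact Nat.not_succ_le_zero 0

/-- **Uniqueness of the decomposition**: if every prime factor of `e ≠ 0` divides `ℓ` and `r ≠ 0`
is prime to `ℓ`, then the `ℓ`-part of `e r` is `e`. [folklore] -/
theorem gcd_pow_mul_eq {ℓ e r : ℕ} (he : e ≠ 0) (heℓ : ∀ p : ℕ, p.Prime → p ∣ e → p ∣ ℓ)
    (hr : r ≠ 0) (hrℓ : ∀ p : ℕ, p.Prime → p ∣ ℓ → ¬ p ∣ r) :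
    Nat.gcd (e * r) (ℓ ^ (e * r)) = e := by
  refine Nat.eq_of_factorization_eq (gcd_pow_ne_zero ℓ _) he fun p => ?_
  rw [factorization_gcd_pow, Nat.factorization_mul he hr, Finsupp.add_apply]
  by_cases hp : p.Prime
  · split_ifs with hpB
    · rw [Nat.factorization_eq_zero_of_not_dvd (hrℓ p hp hpB), add_zero]
    · symm
      exact Nat.factorization_eq_zero_of_not_dvd fun hpq => hpB (heℓ p hp hpq)
  · simp [Nat.factorization_eq_zero_of_not_prime _ hp]

/-! ### The level set split along the `ℓ`-part -/

/-- The `L`-parts occurring in `{n ≤ x : L ∣ n, (n, Q) = 1}`: each is `≥ 1`, `≤ x`, divisible by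
`L`, prime to `Q`, and composed of primes of `L`. [folklore] -/
theorem of_mem_image_gcd_pow {L Q x e : ℕ} (hL : L ≠ 0)
    (he : e ∈ ((Icc 1 x).filter (fun n : ℕ => L ∣ n ∧ n.Coprime Q)).image
      (fun n => Nat.gcd n (L ^ n))) :
    1 ≤ e ∧ e ≤ x ∧ L ∣ e ∧ e.Coprime Q ∧ e.primeFactors ⊆ L.primeFactors := by
  rw [Finset.mem_image] at he
  obtain ⟨n, hn, rfl⟩ := he
  rw [Finset.mem_filter, Finset.mem_Icc] at hn
  have hn0 : n ≠ 0 := by omega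
  refine ⟨Nat.one_le_iff_ne_zero.mpr (gcd_pow_ne_zero L n), ?_, dvd_gcd_pow hn0 hn.2.1,
    Nat.Coprime.coprime_dvd_left (Nat.gcd_dvd_left _ _) hn.2.2, primeFactors_gcd_pow_subset hL n⟩
  exact (Nat.le_of_dvd (by omega) (Nat.gcd_dvd_left _ _)).trans hn.1.2

/-- **Reindexing a fibre**: for such an `e`, the `n` of the level set with `L`-part `e` are
exactly the `e n'` with `n' ≤ x/e`, `(n', Qe) = 1`. [folklore] -/
theorem sum_fiber_gcd_pow_eq {M : Type*} [AddCommMonoid M] (F : ℕ → M) {L Q x e : ℕ} (hL : L ≠ 0)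
    (he : e ∈ ((Icc 1 x).filter (fun n : ℕ => L ∣ n ∧ n.Coprime Q)).image
      (fun n => Nat.gcd n (L ^ n))) :
    ∑ n ∈ ((Icc 1 x).filter (fun n : ℕ => L ∣ n ∧ n.Coprime Q)).filter
        (fun n => Nat.gcd n (L ^ n) = e), F n =
      ∑ n' ∈ (Icc 1 (x / e)).filter (fun n' : ℕ => n'.Coprime (Q * e)), F (e * n') := by
  obtain ⟨he1, -, hLe, heQ, hepf⟩ := of_mem_image_gcd_pow hL he
  have he0 : e ≠ 0 := by omega
  have hpe : ∀ p : ℕ, p.Prime → p ∣ e → p ∣ L := fun p hp hpe =>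
    Nat.dvd_of_mem_primeFactors (hepf (Nat.mem_primeFactors.mpr ⟨hp, hpe, he0⟩))
  refine Finset.sum_nbij' (fun n => n / e) (fun n' => e * n') ?_ ?_ ?_ ?_ ?_
  · intro n hn
    rw [Finset.mem_filter, Finset.mem_filter, Finset.mem_Icc] at hn
    obtain ⟨⟨⟨hn1, hnx⟩, -, hnQ⟩, hne⟩ := hn
    have hn0 : n ≠ 0 := by omega
    have hen : e ∣ n := hne ▸ Nat.gcd_dvd_left _ _
    rw [Finset.mem_filter, Finset.mem_Icc]
    refine ⟨⟨?_, Nat.div_le_div_right hnx⟩, ?_⟩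
    · exact Nat.div_pos (Nat.le_of_dvd (by omega) hen) (by omega)
    · refine Nat.Coprime.mul_right (Nat.Coprime.coprime_dvd_left (Nat.div_dvd_of_dvd hen) hnQ) ?_
      refine Nat.coprime_of_dvd fun p hp hpn hpe' => ?_
      have h1 : ¬ p ∣ n / Nat.gcd n (L ^ n) := not_dvd_div_gcd_pow hp (hpe p hp hpe') hn0
      rw [hne] at h1
      exact h1 hpn
  · intro n' hn'
    rw [Finset.mem_filter, Finset.mem_Icc] at hn'
    obtain ⟨⟨hn1, hnx⟩, hnQe⟩ := hn'
    have hn0 : n' ≠ 0 := by omega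
    rw [Finset.mem_filter, Finset.mem_filter, Finset.mem_Icc]
    refine ⟨⟨⟨le_trans he1 (Nat.le_mul_of_pos_right e (by omega)), ?_⟩,
      dvd_mul_of_dvd_left hLe _, ?_⟩, ?_⟩
    · rw [mul_comm]; exact (Nat.le_div_iff_mul_le (by omega)).mp hnx
    · exact Nat.Coprime.mul_left heQ (Nat.Coprime.coprime_dvd_right (dvd_mul_right Q e) hnQe)
    · refine gcd_pow_mul_eq he0 hpe hn0 fun p hp hpL hpn => ?_
      have hcop : n'.Coprime e := Nat.Coprime.coprime_dvd_right (dvd_mul_left e Q) hnQe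
      have : p ∣ Nat.gcd n' e := Nat.dvd_gcd hpn (hpL.trans hLe)
      rw [hcop] at this
      exact hp.one_lt.ne' (Nat.dvd_one.mp this)
  · intro n hn
    rw [Finset.mem_filter, Finset.mem_filter, Finset.mem_Icc] at hn
    have hen : e ∣ n := hn.2 ▸ Nat.gcd_dvd_left _ _
    exact Nat.mul_div_cancel' hen
  · intro n' _
    exact Nat.mul_div_cancel_left n' (by omega)
  · intro n hn
    rw [Finset.mem_filter, Finset.mem_filter, Finset.mem_Icc] at hn
    have hen : e ∣ n := hn.2 ▸ Nat.gcd_dvd_left _ _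
    rw [Nat.mul_div_cancel' hen]

/-- Splitting the level set along the value of the `L`-part. [folklore] -/
theorem sum_level_eq_sum_image {M : Type*} [AddCommMonoid M] (F : ℕ → M) (L Q x : ℕ) :
    ∑ n ∈ (Icc 1 x).filter (fun n : ℕ => L ∣ n ∧ n.Coprime Q), F n =
      ∑ e ∈ ((Icc 1 x).filter (fun n : ℕ => L ∣ n ∧ n.Coprime Q)).image
          (fun n => Nat.gcd n (L ^ n)),
        ∑ n ∈ ((Icc 1 x).filter (fun n : ℕ => L ∣ n ∧ n.Coprime Q)).filter
          (fun n => Nat.gcd n (L ^ n) = e), F n := by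
  rw [Finset.sum_fiberwise_of_maps_to]
  exact fun n hn => Finset.mem_image_of_mem _ hn

/-! ### Reciprocity for the phase `e(-c T̄ / n)` -/

/-- **Reciprocity**: for coprime `n, T ≥ 1`, with `T̄ = T⁻¹ mod n` and `n̄ = n⁻¹ mod T`,
`e(−c T̄/n) = e(c n̄/T) · e(−c/(Tn))` (because `T T̄ + n n̄ ≡ 1 (mod Tn)`). [folklore] -/
theorem exp_neg_mul_inv_eq {n T : ℕ} (hn : 0 < n) (hT : 0 < T) (hc : n.Coprime T) (c : ℤ) :
    Complex.exp (2 * Real.pi * Complex.I * ((-c * (((T : ZMod n)⁻¹).val : ℤ) : ℤ) : ℂ) / n) =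
      Complex.exp (2 * Real.pi * Complex.I * ((c * (((n : ZMod T)⁻¹).val : ℤ) : ℤ) : ℂ) / T) *
        (𝐞 (((-c : ℤ) : ℝ) * (1 / (T : ℝ)) / (n : ℝ)) : ℂ) := by
  haveI : NeZero n := ⟨hn.ne'⟩
  haveI : NeZero T := ⟨hT.ne'⟩
  have h1 : (T : ℤ) * (((T : ZMod n)⁻¹).val : ℕ) ≡ 1 [ZMOD n] := natCast_mul_inv_val_modEq hc.symm
  have h2 : (n : ℤ) * (((n : ZMod T)⁻¹).val : ℕ) ≡ 1 [ZMOD T] := natCast_mul_inv_val_modEq hc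
  generalize ((T : ZMod n)⁻¹).val = tb at h1 ⊢
  generalize ((n : ZMod T)⁻¹).val = nb at h2 ⊢
  -- `T tb + n nb - 1` is divisible by `n T`
  have hdn : (n : ℤ) ∣ (T : ℤ) * tb + n * nb - 1 := by
    rw [show (T : ℤ) * tb + n * nb - 1 = ((T : ℤ) * tb - 1) + n * nb by ring]
    exact dvd_add (Int.ModEq.dvd h1.symm) (dvd_mul_right _ _)
  have hdT : (T : ℤ) ∣ (T : ℤ) * tb + n * nb - 1 := by
    rw [show (T : ℤ) * tb + n * nb - 1 = ((n : ℤ) * nb - 1) + T * tb by ring]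
    exact dvd_add (Int.ModEq.dvd h2.symm) (dvd_mul_right _ _)
  obtain ⟨k, hk⟩ := (Nat.isCoprime_iff_coprime.2 hc).mul_dvd hdn hdT
  have hnC : (n : ℂ) ≠ 0 := by exact_mod_cast hn.ne'
  have hTC : (T : ℂ) ≠ 0 := by exact_mod_cast hT.ne'
  have hkC : ((T : ℂ) * tb + n * nb - 1) = n * T * k := by exact_mod_cast hk
  have key : 2 * Real.pi * Complex.I * ((-c * (tb : ℤ) : ℤ) : ℂ) / n =
      (2 * Real.pi * Complex.I * ((c * (nb : ℤ) : ℤ) : ℂ) / T +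
        (((2 * Real.pi * (((-c : ℤ) : ℝ) * (1 / (T : ℝ)) / (n : ℝ))) : ℝ) : ℂ) * Complex.I) +
      ((-c * k : ℤ) : ℂ) * (2 * Real.pi * Complex.I) := by
    push_cast
    field_simp
    linear_combination (-(c : ℂ)) * hkC
  rw [Real.fourierChar_apply, ← Complex.exp_add, key, Complex.exp_add (_ + _),
    Complex.exp_int_mul_two_pi_mul_I, mul_one]

/-! ### Completing the square: the roots of `g(q'X + b')` and of the dilate `T²X² − Δ` -/

/-- **Completing the square**.  Let `g = aX² + bX + c₀`, `Δ = b² − 4ac₀`, and let `n ≥ 1` with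
`2aq'` and `T` invertible modulo `n`; put `w = (2aq')⁻¹ (mod n)` and `L = 2ab' + b`.  Then
`m ↦ (Tm − L) w` is a bijection from the roots of `T²X² − Δ` onto the roots of `g(q'X + b')`
modulo `n` (because `4a·g(t) = (2at + b)² − Δ`), whence for every `η ∈ ℤ/n`,
`W_{g(q'X+b')}(η; n) = ψ_n(−η L w) · W_{T²X²−Δ}(η T w; n)`. [folklore] -/
theorem weylSumZMod_comp_eq {n : ℕ} [NeZero n] (a b c₀ q' b' : ℤ) (T : ℕ)
    (hu : IsUnit ((2 * a * q' : ℤ) : ZMod n)) (hT : IsUnit ((T : ℤ) : ZMod n)) (η : ZMod n) :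
    polyRootWeylSumZMod ((C a * X ^ 2 + C b * X + C c₀).comp (C q' * X + C b')) n η =
      ZMod.stdAddChar (-(η * ((2 * a * b' + b : ℤ) : ZMod n) * ((2 * a * q' : ℤ) : ZMod n)⁻¹)) *
        polyRootWeylSumZMod (C ((T : ℤ) ^ 2) * X ^ 2 - C (discrim a b c₀)) n
          (η * ((T : ℤ) : ZMod n) * ((2 * a * q' : ℤ) : ZMod n)⁻¹) := by
  have huw : ((2 * a * q' : ℤ) : ZMod n) * ((2 * a * q' : ℤ) : ZMod n)⁻¹ = 1 :=
    ZMod.mul_inv_of_unit _ hu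
  have hTT : ((T : ℤ) : ZMod n) * ((T : ℤ) : ZMod n)⁻¹ = 1 := ZMod.mul_inv_of_unit _ hT
  generalize ((2 * a * q' : ℤ) : ZMod n)⁻¹ = w at huw ⊢
  generalize ((T : ℤ) : ZMod n)⁻¹ = Ti at hTT ⊢
  have hu2 : ((2 * a * q' : ℤ) : ZMod n) = ((2 * a : ℤ) : ZMod n) * (q' : ZMod n) := by
    push_cast; ring
  have h2a : IsUnit ((2 * a : ℤ) : ZMod n) := by
    rw [hu2] at hu
    exact (IsUnit.mul_iff.mp hu).1
  have h4a : IsUnit ((4 * a : ℤ) : ZMod n) := by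
    have h22 : ((2 * a : ℤ) : ZMod n) = (2 : ZMod n) * (a : ZMod n) := by push_cast; ring
    rw [h22] at h2a
    obtain ⟨h2, ha⟩ := IsUnit.mul_iff.mp h2a
    have : ((4 * a : ℤ) : ZMod n) = 2 * 2 * (a : ZMod n) := by push_cast; ring
    rw [this]; exact (h2.mul h2).mul ha
  -- membership in the two root sets
  have memG : ∀ x : ZMod n,
      x ∈ polyRootsMod ((C a * X ^ 2 + C b * X + C c₀).comp (C q' * X + C b')) n ↔
        (((2 * a : ℤ) : ZMod n) * ((q' : ZMod n) * x + (b' : ZMod n)) + (b : ZMod n)) ^ 2 =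
          ((discrim a b c₀ : ℤ) : ZMod n) := by
    intro x
    rw [mem_polyRootsMod]
    simp only [Polynomial.map_comp, Polynomial.map_add, Polynomial.map_mul, Polynomial.map_pow,
      Polynomial.map_C, Polynomial.map_X, eval_comp, eval_add, eval_mul, eval_pow, eval_C, eval_X]
    simp only [eq_intCast]
    rw [← h4a.mul_right_eq_zero, ← sub_eq_zero (b := ((discrim a b c₀ : ℤ) : ZMod n))]
    unfold discrim
    push_cast
    constructor <;> intro h <;> linear_combination h
  have memF : ∀ m : ZMod n,
      m ∈ polyRootsMod (C ((T : ℤ) ^ 2) * X ^ 2 - C (discrim a b c₀)) n ↔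
        (((T : ℤ) : ZMod n) * m) ^ 2 = ((discrim a b c₀ : ℤ) : ZMod n) := by
    intro m
    rw [mem_polyRootsMod]
    simp only [Polynomial.map_sub, Polynomial.map_mul, Polynomial.map_pow, Polynomial.map_C,
      Polynomial.map_X, eval_sub, eval_mul, eval_pow, eval_C, eval_X]
    simp only [eq_intCast]
    rw [sub_eq_zero]
    push_cast
    ring_nf
  have hL' : ((2 * a : ℤ) : ZMod n) * (b' : ZMod n) + (b : ZMod n) =
      ((2 * a * b' + b : ℤ) : ZMod n) := by push_cast; ring
  generalize ((2 * a * b' + b : ℤ) : ZMod n) = L at hL' ⊢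
  generalize ((2 * a * q' : ℤ) : ZMod n) = u at huw hu2 ⊢
  generalize ((T : ℤ) : ZMod n) = Tn at hTT memF ⊢
  unfold polyRootWeylSumZMod
  rw [Finset.mul_sum]
  symm
  refine Finset.sum_nbij' (fun m : ZMod n => (Tn * m - L) * w)
    (fun x : ZMod n => (u * x + L) * Ti) ?_ ?_ ?_ ?_ ?_
  · intro m hm
    rw [memF] at hm
    rw [memG, ← hm]
    have : ((2 * a : ℤ) : ZMod n) * ((q' : ZMod n) * ((Tn * m - L) * w) + (b' : ZMod n)) +
        (b : ZMod n) = Tn * m := by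
      calc _ = (((2 * a : ℤ) : ZMod n) * (q' : ZMod n)) * ((Tn * m - L) * w) +
            (((2 * a : ℤ) : ZMod n) * (b' : ZMod n) + (b : ZMod n)) := by ring
        _ = (Tn * m - L) * (u * w) + L := by rw [← hu2, hL']; ring
        _ = Tn * m := by rw [huw]; ring
    rw [this]
  · intro x hx
    rw [memG] at hx
    rw [memF, ← hx]
    have : Tn * ((u * x + L) * Ti) = u * x + L := by
      calc _ = (Tn * Ti) * (u * x + L) := by ring
        _ = u * x + L := by rw [hTT, one_mul]
    rw [this, hu2, ← hL']
    ring
  · intro m _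
    calc (u * ((Tn * m - L) * w) + L) * Ti = ((u * w) * (Tn * m - L) + L) * Ti := by ring
      _ = m * (Tn * Ti) := by rw [huw]; ring
      _ = m := by rw [hTT, mul_one]
  · intro x _
    calc (Tn * ((u * x + L) * Ti) - L) * w = ((Tn * Ti) * (u * x + L) - L) * w := by ring
      _ = x * (u * w) := by rw [hTT]; ring
      _ = x := by rw [huw, mul_one]
  · intro m _
    rw [← AddChar.map_add_eq_mul]
    congr 1
    ring

/-! ### The Weyl sum to the modulus `e n'` -/

/-- The unit algebra behind the reduction (in any commutative ring): if `T = U·(SDE)`,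
`U W = 1`, `T T' = 1`, `E E' = 1`, then `(hE') T W = hSD` and `(hE') L W = (hSDL) T'`.
[folklore] -/
theorem unit_algebra {R : Type*} [CommRing R] (h S D E EI U W TT TI L : R)
    (hT : TT = U * (S * D * E)) (hw : U * W = 1) (hTT : TT * TI = 1) (hee : E * EI = 1) :
    h * EI * TT * W = h * S * D ∧ -(h * EI * L * W) = -(h * S * D * L) * TI := by
  have hW : W = S * D * E * TI := by
    calc W = W * (TT * TI) := by rw [hTT, mul_one]
      _ = (U * W) * (S * D * E * TI) := by rw [hT]; ring
      _ = _ := by rw [hw, one_mul]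
  constructor
  · calc h * EI * TT * W = h * S * D * (E * EI) * (U * W) := by rw [hT]; ring
      _ = _ := by rw [hee, hw, mul_one, mul_one]
  · rw [hW]
    calc -(h * EI * L * (S * D * E * TI)) = -(h * S * D * L) * TI * (E * EI) := by ring
      _ = _ := by rw [hee, mul_one]

/-- **The reduction to the dilate, one modulus at a time.**  Let `g = aX² + bX + c₀`,
`Δ = b² − 4ac₀`, `T = q|2aΔ|e`, `(n', T) = 1`.  Then
`S_{g(qX+b₁)}(h; e n') = Λ(u) · e(−c/(Tn')) · S_{T²X²−Δ}(h''; n')`, `u = n' mod T`,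
`h'' = h·sign(2aΔ)·Δ`, `c = h''(2ab₁ + b)`, `Λ(u) = S_{g(qX+b₁)}(h ū_e; e) · e(c ū_T/T)` (`ū` the
inverse of `u` modulo `e`, resp. `T`): twisted multiplicativity, completing the square and
reciprocity. [folklore] -/
theorem weylSum_mul_eq (a b c₀ : ℤ) {Δ : ℤ} (hΔ : discrim a b c₀ = Δ) (q b₁ e : ℕ) (h : ℤ)
    (hq : 0 < q) (hB : (2 * a * Δ).natAbs ≠ 0) (he : 0 < e) {n' : ℕ} (hn : 0 < n')
    {T : ℕ} (hT : T = q * (2 * a * Δ).natAbs * e) (hcop : n'.Coprime T) :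
    polyRootWeylSum ((C a * X ^ 2 + C b * X + C c₀).comp (C (q : ℤ) * X + C (b₁ : ℤ))) (e * n') h =
      (polyRootWeylSum ((C a * X ^ 2 + C b * X + C c₀).comp (C (q : ℤ) * X + C (b₁ : ℤ))) e
          (h * (((((n' % T : ℕ) : ZMod e)⁻¹).val : ℕ) : ℤ)) *
        Complex.exp (2 * Real.pi * Complex.I *
          ((h * Int.sign (2 * a * Δ) * Δ * (2 * a * b₁ + b) *
            (((((n' % T : ℕ) : ZMod T)⁻¹).val : ℕ) : ℤ) : ℤ) : ℂ) / (T : ℕ))) *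
      ((𝐞 (((-(h * Int.sign (2 * a * Δ) * Δ * (2 * a * b₁ + b)) : ℤ) : ℝ) * (1 / (T : ℝ)) /
          (n' : ℝ)) : ℂ) *
        polyRootWeylSum (C ((T : ℤ) ^ 2) * X ^ 2 - C Δ) n' (h * Int.sign (2 * a * Δ) * Δ)) := by
  subst hΔ
  have hT0 : 0 < T := by
    rw [hT]; exact Nat.mul_pos (Nat.mul_pos hq (Nat.pos_of_ne_zero hB)) he
  haveI : NeZero e := ⟨he.ne'⟩
  haveI : NeZero n' := ⟨hn.ne'⟩
  haveI : NeZero T := ⟨hT0.ne'⟩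
  have heT : e ∣ T := by rw [hT]; exact dvd_mul_left _ _
  have hen : e.Coprime n' := (Nat.Coprime.coprime_dvd_right heT hcop).symm
  -- the residue `u = n' mod T`
  have hue : (((n' % T : ℕ)) : ZMod e) = (n' : ZMod e) := by
    rw [ZMod.natCast_eq_natCast_iff', Nat.mod_mod_of_dvd _ heT]
  have huT : (((n' % T : ℕ)) : ZMod T) = (n' : ZMod T) := ZMod.natCast_mod _ _
  -- twisted multiplicativity
  have he₁ : (e : ℤ) * ((((e : ZMod n')⁻¹).val : ℕ) : ℤ) ≡ 1 [ZMOD n'] :=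
    natCast_mul_inv_val_modEq hen
  have he₂ : (n' : ℤ) * (((((n' % T : ℕ) : ZMod e))⁻¹.val : ℕ) : ℤ) ≡ 1 [ZMOD e] := by
    rw [hue]; exact natCast_mul_inv_val_modEq hen.symm
  rw [polyRootWeylSum_mul_of_coprime _ hen he₁ he₂ h]
  -- completing the square
  have hTu : IsUnit (((T : ℕ) : ℤ) : ZMod n') := by
    rw [Int.cast_natCast]; exact (ZMod.unitOfCoprime _ hcop.symm).isUnit
  have hBint : (((2 * a * discrim a b c₀).natAbs : ℕ) : ℤ) =
      Int.sign (2 * a * discrim a b c₀) * (2 * a * discrim a b c₀) :=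
    (Int.sign_mul_self_eq_natAbs _).symm
  have hTfac : ((T : ℕ) : ℤ) =
      (2 * a * q) * (Int.sign (2 * a * discrim a b c₀) * discrim a b c₀ * e) := by
    rw [hT, Nat.cast_mul, Nat.cast_mul, hBint]; ring
  have hTfac' : (((T : ℕ) : ℤ) : ZMod n') = ((2 * a * (q : ℤ) : ℤ) : ZMod n') *
      (((Int.sign (2 * a * discrim a b c₀) : ℤ) : ZMod n') * ((discrim a b c₀ : ℤ) : ZMod n') *
        (e : ZMod n')) := by
    rw [hTfac]; simp only [Int.cast_mul, Int.cast_natCast]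
  have h2aq : IsUnit ((2 * a * (q : ℤ) : ℤ) : ZMod n') := by
    rw [hTfac'] at hTu
    exact (IsUnit.mul_iff.mp hTu).1
  rw [polyRootWeylSum_eq_zmod _ n', weylSumZMod_comp_eq a b c₀ (q : ℤ) (b₁ : ℤ) T h2aq hTu]
  -- the unit equations in `ZMod n'`
  have hw : ((2 * a * (q : ℤ) : ℤ) : ZMod n') * ((2 * a * (q : ℤ) : ℤ) : ZMod n')⁻¹ = 1 :=
    ZMod.mul_inv_of_unit _ h2aq
  have hTT : (((T : ℕ) : ℤ) : ZMod n') * (((T : ℕ) : ℤ) : ZMod n')⁻¹ = 1 :=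
    ZMod.mul_inv_of_unit _ hTu
  have hee : (e : ZMod n') * ((((e : ZMod n')⁻¹).val : ℕ) : ZMod n') = 1 := by
    rw [ZMod.natCast_zmod_val]; exact ZMod.coe_mul_inv_eq_one _ hen
  obtain ⟨hfreq', hph'⟩ := unit_algebra (h : ZMod n')
    ((Int.sign (2 * a * discrim a b c₀) : ℤ) : ZMod n')
    ((discrim a b c₀ : ℤ) : ZMod n') (e : ZMod n') ((((e : ZMod n')⁻¹).val : ℕ) : ZMod n')
    ((2 * a * (q : ℤ) : ℤ) : ZMod n') ((2 * a * (q : ℤ) : ℤ) : ZMod n')⁻¹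
    (((T : ℕ) : ℤ) : ZMod n') (((T : ℕ) : ℤ) : ZMod n')⁻¹
    ((2 * a * (b₁ : ℤ) + b : ℤ) : ZMod n') hTfac' hw hTT hee
  -- the frequency
  have hfreq : (((h * ((((e : ZMod n')⁻¹).val : ℕ) : ℤ) : ℤ) : ZMod n')) *
      (((T : ℕ) : ℤ) : ZMod n') * ((2 * a * (q : ℤ) : ℤ) : ZMod n')⁻¹ =
      ((h * Int.sign (2 * a * discrim a b c₀) * discrim a b c₀ : ℤ) : ZMod n') := by
    simp only [Int.cast_mul, Int.cast_natCast] at hfreq' ⊢; exact hfreq'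
  -- the phase
  have hph : -((((h * ((((e : ZMod n')⁻¹).val : ℕ) : ℤ) : ℤ) : ZMod n')) *
      ((2 * a * (b₁ : ℤ) + b : ℤ) : ZMod n') * ((2 * a * (q : ℤ) : ℤ) : ZMod n')⁻¹) =
      (((-(h * Int.sign (2 * a * discrim a b c₀) * discrim a b c₀ * (2 * a * b₁ + b)) *
        (((((T : ℕ) : ZMod n'))⁻¹.val : ℕ) : ℤ)) : ℤ) : ZMod n') := by
    simp only [Int.cast_mul, Int.cast_neg, Int.cast_add, Int.cast_natCast, ZMod.natCast_zmod_val]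
      at hph' ⊢
    exact hph'
  rw [hfreq, hph, ZMod.stdAddChar_coe, ← polyRootWeylSum_eq_zmod,
    exp_neg_mul_inv_eq hn hT0 hcop, huT.symm]
  push_cast
  ring

/-! ### One fibre: classes modulo `T`, Abel summation, the lever -/

/-- `‖e(k/T)‖ = 1` for the phases `exp(2πi k/T)`. [folklore] -/
theorem norm_exp_int_div (k : ℤ) (T : ℕ) :
    ‖Complex.exp (2 * Real.pi * Complex.I * (k : ℂ) / (T : ℂ))‖ = 1 := by
  rw [show (2 * Real.pi * Complex.I * (k : ℂ) / (T : ℂ)) =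
      ((2 * Real.pi * k / T : ℝ) : ℂ) * Complex.I by push_cast; ring]
  exact Complex.norm_exp_ofReal_mul_I _

/-- **The main bound on one fibre.**  Suppose the CLASS BOUND for the dilates of `X² − D`:
`|∑_{m ≤ M, m ≡ u (Q), (m,Q)=1} S_{Q²X²−D}(h; m)| ≤ K Q^A |h|^A M^{1−η}` for all `Q ≥ 1`, `u`,
`h ≠ 0`, `M` (`η ≤ 1`, `K ≥ 0`).  Then for `g = aX² + bX + c₀` of discriminant `D`, `e ≥ 1`,
`x' ∈ ℕ` and `T = q|2aD|e`:
`|∑_{n' ≤ x', (n',T)=1} S_{g(qX+b₁)}(h; e n')| ≤ T · e · (1 + 2π|c|/T) · K T^A |h''|^A x'^{1−η}`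
(`weylSum_mul_eq`, classes modulo `T`, Abel summation against the flat phase
`TypeIFromWeyl.norm_sum_Ioc_mul_le`, the class bound in each class). [folklore] -/
theorem norm_sum_fiber_le {D : ℤ} {η A K : ℝ} (hη2 : η ≤ 1) (hK0 : 0 ≤ K)
    (HB : ∀ (Q u : ℕ) (h : ℤ) (M : ℕ), 0 < Q → h ≠ 0 →
      ‖∑ m ∈ (Icc 1 M).filter (fun m : ℕ => m ≡ u [MOD Q] ∧ m.Coprime Q),
        polyRootWeylSum (C ((Q : ℤ) ^ 2) * X ^ 2 - C D) m h‖ ≤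
          K * (Q : ℝ) ^ A * |(h : ℝ)| ^ A * (M : ℝ) ^ (1 - η))
    (a b c₀ : ℤ) (hD : discrim a b c₀ = D) (q b₁ e : ℕ) (h : ℤ) (hq : 0 < q)
    (hB : (2 * a * D).natAbs ≠ 0) (he : 0 < e) (hh0 : h * Int.sign (2 * a * D) * D ≠ 0)
    {T : ℕ} (hT : T = q * (2 * a * D).natAbs * e) (x' : ℕ) :
    ‖∑ n' ∈ (Icc 1 x').filter (fun n' : ℕ => n'.Coprime T),
        polyRootWeylSum ((C a * X ^ 2 + C b * X + C c₀).comp (C (q : ℤ) * X + C (b₁ : ℤ)))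
          (e * n') h‖ ≤
      (T : ℝ) * e * (1 + 2 * Real.pi *
          |((h * Int.sign (2 * a * D) * D * (2 * a * b₁ + b) : ℤ) : ℝ)| / (T : ℝ)) *
        (K * (T : ℝ) ^ A * |((h * Int.sign (2 * a * D) * D : ℤ) : ℝ)| ^ A *
          (x' : ℝ) ^ (1 - η)) := by
  -- abbreviations
  set G : ℤ[X] := (C a * X ^ 2 + C b * X + C c₀).comp (C (q : ℤ) * X + C (b₁ : ℤ)) with hG
  set hh : ℤ := h * Int.sign (2 * a * D) * D with hhh
  set cc : ℤ := h * Int.sign (2 * a * D) * D * (2 * a * b₁ + b) with hcc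
  set Lam : ℕ → ℂ := fun u => polyRootWeylSum G e (h * (((((u : ℕ) : ZMod e)⁻¹).val : ℕ) : ℤ)) *
    Complex.exp (2 * Real.pi * Complex.I *
      ((cc * (((((u : ℕ) : ZMod T)⁻¹).val : ℕ) : ℤ) : ℤ) : ℂ) / (T : ℕ)) with hLam
  set phase : ℕ → ℂ := fun n => (𝐞 (((-cc : ℤ) : ℝ) * (1 / (T : ℝ)) / (n : ℝ)) : ℂ) with hphase
  set F : ℤ[X] := C ((T : ℤ) ^ 2) * X ^ 2 - C D with hF
  have hT0 : 0 < T := by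
    rw [hT]; exact Nat.mul_pos (Nat.mul_pos hq (Nat.pos_of_ne_zero hB)) he
  have hTr : (0 : ℝ) < T := by exact_mod_cast hT0
  set Φ : ℝ := K * (T : ℝ) ^ A * |(hh : ℝ)| ^ A * (x' : ℝ) ^ (1 - η) with hΦ
  have hΦ0 : 0 ≤ Φ := by rw [hΦ]; positivity
  set V : ℝ := 2 * Real.pi * |(cc : ℝ)| / (T : ℝ) with hV
  have hV0 : 0 ≤ V := by rw [hV]; positivity
  set S' := (Icc 1 x').filter (fun n' : ℕ => n'.Coprime T) with hS'
  -- the norms of `Λ` and of the phase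
  have hLam1 : ∀ u : ℕ, ‖Lam u‖ ≤ e := by
    intro u
    rw [hLam]; dsimp only
    rw [norm_mul, norm_exp_int_div, mul_one]
    refine (norm_polyRootWeylSum_le _ _ _).trans ?_
    exact_mod_cast polyRootCountMod_le _ _
  have hphase1 : ∀ n : ℕ, ‖phase n‖ ≤ 1 := fun n => by rw [hphase]; exact (Circle.norm_coe _).le
  -- Step 1: the pointwise identity
  have hpt : ∀ n' ∈ S', polyRootWeylSum G (e * n') h =
      Lam (n' % T) * (phase n' * polyRootWeylSum F n' hh) := by
    intro n' hn'
    rw [hS', Finset.mem_filter, Finset.mem_Icc] at hn'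
    have := weylSum_mul_eq a b c₀ hD q b₁ e h hq hB he (by omega : 0 < n') hT hn'.2
    rw [this, hLam, hphase, hcc]
  rw [Finset.sum_congr rfl hpt]
  -- Step 2: classes modulo `T`
  rw [← Finset.sum_fiberwise_of_maps_to (s := S') (t := Finset.range T) (g := fun n' => n' % T)
    (fun n' _ => Finset.mem_range.mpr (Nat.mod_lt _ hT0))]
  have hinner : ∀ u ∈ Finset.range T,
      ∑ n' ∈ S'.filter (fun n' => n' % T = u), Lam (n' % T) *
          (phase n' * polyRootWeylSum F n' hh) =
        Lam u * ∑ n' ∈ S'.filter (fun n' => n' % T = u), phase n' * polyRootWeylSum F n' hh := by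
    intro u _
    rw [Finset.mul_sum]
    refine Finset.sum_congr rfl fun n' hn' => ?_
    rw [(Finset.mem_filter.mp hn').2]
  rw [Finset.sum_congr rfl hinner]
  -- Step 3: each class by Abel summation
  have hclass : ∀ u ∈ Finset.range T,
      ‖∑ n' ∈ S'.filter (fun n' => n' % T = u), phase n' * polyRootWeylSum F n' hh‖ ≤
        (1 + V) * Φ := by
    intro u hu
    rw [Finset.mem_range] at hu
    rcases Nat.eq_zero_or_pos x' with hx0 | hx0
    · have : S'.filter (fun n' => n' % T = u) = ∅ := by
        rw [hS', hx0]; rfl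
      rw [this, Finset.sum_empty, norm_zero]; positivity
    set w : ℕ → ℂ := fun n => if (n % T = u ∧ n.Coprime T) then polyRootWeylSum F n hh else 0
      with hw
    have hIcc : ∀ k : ℕ, Icc 1 k = Ioc 0 k := fun k => by
      ext n; simp only [Finset.mem_Icc, Finset.mem_Ioc]; omega
    have hsum : ∑ n' ∈ S'.filter (fun n' => n' % T = u), phase n' * polyRootWeylSum F n' hh =
        ∑ n ∈ Ioc 0 x', phase n * w n := by
      rw [hS', Finset.filter_filter, ← hIcc, Finset.sum_filter]
      refine Finset.sum_congr rfl fun n _ => ?_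
      rw [hw]; dsimp only
      by_cases hc : n.Coprime T ∧ n % T = u
      · rw [if_pos hc, if_pos ⟨hc.2, hc.1⟩]
      · rw [if_neg hc, if_neg (fun h' => hc ⟨h'.2, h'.1⟩), mul_zero]
    rw [hsum]
    refine TypeIFromWeyl.norm_sum_Ioc_mul_le phase w hΦ0 ?_ hphase1 ?_
    · -- partial sums: the class bound
      intro k _ hk
      have hws : ∑ n ∈ Ioc 0 k, w n = ∑ m ∈ (Icc 1 k).filter
          (fun m : ℕ => m ≡ u [MOD T] ∧ m.Coprime T),
            polyRootWeylSum (C ((T : ℤ) ^ 2) * X ^ 2 - C D) m hh := by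
        rw [hIcc, Finset.sum_filter]
        refine Finset.sum_congr rfl fun n _ => ?_
        rw [hw]; dsimp only
        have hiff : (n % T = u ∧ n.Coprime T) ↔ (n ≡ u [MOD T] ∧ n.Coprime T) := by
          rw [Nat.ModEq, Nat.mod_eq_of_lt hu]
        split_ifs with h1 h2 h2
        · rfl
        · exact absurd (hiff.mp h1) h2
        · exact absurd (hiff.mpr h2) h1
        · rfl
      rw [hws]
      refine (HB T u hh k hT0 hh0).trans ?_
      rw [hΦ]
      apply mul_le_mul_of_nonneg_left _ (by positivity)
      exact Real.rpow_le_rpow (Nat.cast_nonneg _) (by exact_mod_cast hk) (by linarith)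
    · -- variation of the phase
      have hx1 : 0 + 1 ≤ x' := hx0
      have hv := TypeIFromWeyl.sum_norm_phase_sub_le (-cc) (1 / (T : ℝ)) hx1
      refine le_trans (le_of_eq ?_) (hv.trans ?_)
      · rfl
      · rw [hV]
        push_cast
        rw [abs_neg, abs_of_pos (by positivity : (0 : ℝ) < 1 / T)]
        have h1 : (1 : ℝ) / (0 + 1) - 1 / x' ≤ 1 := by
          have : (0 : ℝ) ≤ 1 / x' := by positivity
          linarith
        have h2 : 0 ≤ 2 * Real.pi * |(cc : ℝ)| * (1 / T) := by positivity
        calc 2 * Real.pi * |(cc : ℝ)| * (1 / T) * (1 / (0 + 1) - 1 / x')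
            ≤ 2 * Real.pi * |(cc : ℝ)| * (1 / T) * 1 := mul_le_mul_of_nonneg_left h1 h2
          _ = 2 * Real.pi * |(cc : ℝ)| / T := by ring
  -- Step 4: add up the classes
  refine (norm_sum_le _ _).trans ?_
  calc ∑ u ∈ Finset.range T, ‖Lam u * ∑ n' ∈ S'.filter (fun n' => n' % T = u),
          phase n' * polyRootWeylSum F n' hh‖
      ≤ ∑ u ∈ Finset.range T, (e : ℝ) * ((1 + V) * Φ) := by
        refine Finset.sum_le_sum fun u hu => ?_
        rw [norm_mul]
        exact mul_le_mul (hLam1 u) (hclass u hu) (norm_nonneg _) (Nat.cast_nonneg _)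
    _ = (T : ℝ) * e * (1 + V) * Φ := by
        rw [Finset.sum_const, Finset.card_range, nsmul_eq_mul]; ring
    _ = _ := by rw [hV, hΦ, hcc, hhh]

/-! ### Rankin's trick for the numbers composed of the primes of `L` -/

/-- `p^{-1/2} ≤ 3/4` for `p ≥ 2`. [folklore] -/
theorem rpow_neg_half_le {p : ℕ} (hp : 2 ≤ p) : (p : ℝ) ^ (-(1 / 2 : ℝ)) ≤ 3 / 4 := by
  have hp0 : (0 : ℝ) < p := by exact_mod_cast (show 0 < p by omega)
  have h2 : (2 : ℝ) ≤ p := by exact_mod_cast hp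
  rw [Real.rpow_neg hp0.le, ← Real.sqrt_eq_rpow]
  rw [inv_le_comm₀ (Real.sqrt_pos.mpr hp0) (by norm_num)]
  rw [Real.le_sqrt (by norm_num) hp0.le]
  nlinarith

/-- **Rankin**: if every element of `D` is `≥ 1` with all prime factors dividing `L ≠ 0`, then
`∑_{d ∈ D} d^{−1/2} ≤ ∏_{p ∣ L} (1 − p^{−1/2})⁻¹ ≤ 4^{ω(L)} ≤ L²` (Euler product majorant
`BombieriSieve.sum_le_prod_tsum_of_factored`, `2^{ω(L)} ≤ L`). [folklore] -/
theorem sum_rpow_neg_half_le {L : ℕ} (hL : L ≠ 0) {D : Finset ℕ}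
    (hD : ∀ d ∈ D, d ≠ 0 ∧ d.primeFactors ⊆ L.primeFactors) :
    ∑ d ∈ D, (d : ℝ) ^ (-(1 / 2 : ℝ)) ≤ (L : ℝ) ^ 2 := by
  have hfac : ∀ d ∈ D, d ∈ Nat.factoredNumbers L.primeFactors := by
    intro d hd
    obtain ⟨hd0, hsub⟩ := hD d hd
    rw [Nat.mem_factoredNumbers']
    intro p hp hpd
    exact hsub (Nat.mem_primeFactors.mpr ⟨hp, hpd, hd0⟩)
  have hgeom : ∀ {p : ℕ}, p.Prime → ∀ k : ℕ,
      (((p ^ k : ℕ) : ℝ)) ^ (-(1 / 2 : ℝ)) = ((p : ℝ) ^ (-(1 / 2 : ℝ))) ^ k := by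
    intro p _ k
    rw [Nat.cast_pow, Real.rpow_pow_comm (Nat.cast_nonneg _)]
  have hr1 : ∀ {p : ℕ}, p.Prime → (p : ℝ) ^ (-(1 / 2 : ℝ)) < 1 := fun hp =>
    Real.rpow_lt_one_of_one_lt_of_neg (by exact_mod_cast hp.one_lt) (by norm_num)
  have hr0 : ∀ p : ℕ, 0 ≤ (p : ℝ) ^ (-(1 / 2 : ℝ)) := fun p => Real.rpow_nonneg (Nat.cast_nonneg _) _
  have hle := BombieriSieve.sum_le_prod_tsum_of_factored (h := fun n : ℕ => (n : ℝ) ^ (-(1 / 2 : ℝ)))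
    (by simp) (fun {m n} _ => by rw [Nat.cast_mul, Real.mul_rpow (Nat.cast_nonneg _) (Nat.cast_nonneg _)])
    (fun n => hr0 n)
    (fun {p} hp => by
      simp_rw [hgeom hp]
      exact summable_geometric_of_lt_one (hr0 p) (hr1 hp))
    (s := L.primeFactors) (fun _ hp => Nat.prime_of_mem_primeFactors hp) hfac
  refine hle.trans ?_
  have hterm : ∀ p ∈ L.primeFactors, ∑' k : ℕ, (((p ^ k : ℕ) : ℝ)) ^ (-(1 / 2 : ℝ)) ≤ 4 := by
    intro p hp
    have hpp := Nat.prime_of_mem_primeFactors hp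
    simp_rw [hgeom hpp]
    rw [tsum_geometric_of_lt_one (hr0 p) (hr1 hpp)]
    have h34 := rpow_neg_half_le hpp.two_le
    rw [inv_le_comm₀ (by linarith [hr1 hpp]) (by norm_num)]
    linarith
  calc ∏ p ∈ L.primeFactors, ∑' k : ℕ, (((p ^ k : ℕ) : ℝ)) ^ (-(1 / 2 : ℝ))
      ≤ ∏ p ∈ L.primeFactors, (4 : ℝ) :=
        Finset.prod_le_prod (fun _ _ => tsum_nonneg fun _ => hr0 _) hterm
    _ = ((2 : ℝ) ^ L.primeFactors.card) ^ 2 := by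
        rw [Finset.prod_const, ← pow_mul, mul_comm, pow_mul]; norm_num
    _ ≤ (L : ℝ) ^ 2 := by
        gcongr
        have h1 : 2 ^ L.primeFactors.card ≤ ∏ p ∈ L.primeFactors, p :=
          Finset.pow_card_le_prod _ _ 2 fun _ hp => (Nat.prime_of_mem_primeFactors hp).two_le
        have h2 : ∏ p ∈ L.primeFactors, p ≤ L := Nat.le_of_dvd (Nat.pos_of_ne_zero hL)
          (Nat.prod_primeFactors_dvd L)
        exact_mod_cast h1.trans h2

/-! ### The uniform level Weyl bound: small and large `L`-parts -/

/-- `1 + 2π|c|/T ≤ 8(1 + |b|)|h|` for `T = q|2aΔ|e`, `c = h·sign(2aΔ)·Δ·(2ab₁ + b)`, `b₁ < q`,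
`e ≥ 1`. [folklore] -/
theorem one_add_phase_coeff_le {a b Δ : ℤ} (ha : a ≠ 0) (hΔ : Δ ≠ 0) {q b₁ e : ℕ}
    (hq : 0 < q) (hb₁ : b₁ < q) (he : 0 < e) {h : ℤ} (hh0 : h ≠ 0) :
    1 + 2 * Real.pi * |((h * Int.sign (2 * a * Δ) * Δ * (2 * a * b₁ + b) : ℤ) : ℝ)| /
        ((q * (2 * a * Δ).natAbs * e : ℕ) : ℝ) ≤
      8 * (1 + |(b : ℝ)|) * |(h : ℝ)| := by
  have hpi := Real.pi_lt_d2
  have hh1 : (1 : ℝ) ≤ |(h : ℝ)| := by rw [← Int.cast_abs]; exact_mod_cast Int.one_le_abs hh0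
  have ha1 : (1 : ℝ) ≤ |(a : ℝ)| := by rw [← Int.cast_abs]; exact_mod_cast Int.one_le_abs ha
  have hΔ1 : (1 : ℝ) ≤ |(Δ : ℝ)| := by rw [← Int.cast_abs]; exact_mod_cast Int.one_le_abs hΔ
  have hq1 : (1 : ℝ) ≤ q := by exact_mod_cast hq
  have he1 : (1 : ℝ) ≤ e := by exact_mod_cast he
  have hb₁q : (b₁ : ℝ) ≤ q := by exact_mod_cast hb₁.le
  have hb0 : (0 : ℝ) ≤ b₁ := Nat.cast_nonneg _
  -- `T = q · 2|a||Δ| · e`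
  have hT : ((q * (2 * a * Δ).natAbs * e : ℕ) : ℝ) = q * (2 * |(a : ℝ)| * |(Δ : ℝ)|) * e := by
    push_cast
    rw [Nat.cast_natAbs, Int.cast_abs]; push_cast
    rw [abs_mul, abs_mul, abs_two]
  -- `|c| = |h| |Δ| |2ab₁ + b| ≤ |h| |Δ| (2|a|q + |b|)`
  have h2aΔ : 2 * a * Δ ≠ 0 := mul_ne_zero (mul_ne_zero two_ne_zero ha) hΔ
  have hsign : |((Int.sign (2 * a * Δ) : ℤ) : ℝ)| = 1 := by
    rw [← Int.cast_abs, Int.abs_sign_of_ne_zero h2aΔ]; simp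
  have hc : |((h * Int.sign (2 * a * Δ) * Δ * (2 * a * b₁ + b) : ℤ) : ℝ)| ≤
      |(h : ℝ)| * |(Δ : ℝ)| * (2 * |(a : ℝ)| * q + |(b : ℝ)|) := by
    push_cast
    rw [abs_mul, abs_mul, abs_mul, hsign, mul_one]
    refine mul_le_mul_of_nonneg_left ?_ (by positivity)
    calc |2 * (a : ℝ) * b₁ + b| ≤ |2 * (a : ℝ) * b₁| + |(b : ℝ)| := abs_add_le _ _
      _ = 2 * |(a : ℝ)| * b₁ + |(b : ℝ)| := by rw [abs_mul, abs_mul, abs_two, abs_of_nonneg hb0]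
      _ ≤ _ := by nlinarith
  have hTpos : (0 : ℝ) < ((q * (2 * a * Δ).natAbs * e : ℕ) : ℝ) := by rw [hT]; positivity
  have hfrac : 2 * Real.pi * |((h * Int.sign (2 * a * Δ) * Δ * (2 * a * b₁ + b) : ℤ) : ℝ)| /
      ((q * (2 * a * Δ).natAbs * e : ℕ) : ℝ) ≤ 2 * Real.pi * (|(h : ℝ)| * (1 + |(b : ℝ)|)) := by
    rw [div_le_iff₀ hTpos, hT]
    have h1 : |(h : ℝ)| * |(Δ : ℝ)| * (2 * |(a : ℝ)| * q + |(b : ℝ)|) ≤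
        |(h : ℝ)| * (1 + |(b : ℝ)|) * (q * (2 * |(a : ℝ)| * |(Δ : ℝ)|) * e) := by
      have h2 : |(Δ : ℝ)| * (2 * |(a : ℝ)| * q + |(b : ℝ)|) ≤
          (1 + |(b : ℝ)|) * (q * (2 * |(a : ℝ)| * |(Δ : ℝ)|) * e) := by
        have h2a : (1 : ℝ) ≤ 2 * |(a : ℝ)| := by linarith
        have h3 : |(b : ℝ)| ≤ |(b : ℝ)| * (q * (2 * |(a : ℝ)|) * e) := by
          have : (1 : ℝ) ≤ q * (2 * |(a : ℝ)|) * e :=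
            one_le_mul_of_one_le_of_one_le (one_le_mul_of_one_le_of_one_le hq1 h2a) he1
          exact le_mul_of_one_le_right (abs_nonneg _) this
        have h4 : (2 * |(a : ℝ)| * q) ≤ q * (2 * |(a : ℝ)|) * e := by
          rw [mul_comm (2 * |(a : ℝ)|) (q : ℝ)]
          exact le_mul_of_one_le_right (by positivity) he1
        nlinarith [abs_nonneg (b : ℝ), abs_nonneg (a : ℝ)]
      calc _ = |(h : ℝ)| * (|(Δ : ℝ)| * (2 * |(a : ℝ)| * q + |(b : ℝ)|)) := by ring
        _ ≤ |(h : ℝ)| * ((1 + |(b : ℝ)|) * (q * (2 * |(a : ℝ)| * |(Δ : ℝ)|) * e)) :=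
            mul_le_mul_of_nonneg_left h2 (by positivity)
        _ = _ := by ring
    calc 2 * Real.pi * |((h * Int.sign (2 * a * Δ) * Δ * (2 * a * b₁ + b) : ℤ) : ℝ)|
        ≤ 2 * Real.pi * (|(h : ℝ)| * |(Δ : ℝ)| * (2 * |(a : ℝ)| * q + |(b : ℝ)|)) :=
          mul_le_mul_of_nonneg_left hc (by positivity)
      _ ≤ 2 * Real.pi * (|(h : ℝ)| * (1 + |(b : ℝ)|) * (q * (2 * |(a : ℝ)| * |(Δ : ℝ)|) * e)) :=
          mul_le_mul_of_nonneg_left h1 (by positivity)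
      _ = _ := by ring
  have h5 : (1 : ℝ) ≤ |(h : ℝ)| * (1 + |(b : ℝ)|) := by nlinarith [abs_nonneg (b : ℝ)]
  nlinarith [abs_nonneg (b : ℝ)]

/-- **Small `L`-parts.**  Under the class bound, for `e` in the image of the `L`-part with
`e ≤ E₀` (`E₀ ≥ 1`):
`|∑_{fibre of e} S_{g(qX+b₁)}(h; n)| ≤ 8(1+|b|) K |D|^A · Q^{A+1} E₀^{A+2} |h|^{A+1} x^{1−η}`,
`Q = q|2aD|`. [folklore] -/
theorem norm_sum_small_fiber_le {D : ℤ} {η A K : ℝ} (hη2 : η ≤ 1) (hA0 : 0 ≤ A) (hK0 : 0 ≤ K)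
    (HB : ∀ (Q u : ℕ) (h : ℤ) (M : ℕ), 0 < Q → h ≠ 0 →
      ‖∑ m ∈ (Icc 1 M).filter (fun m : ℕ => m ≡ u [MOD Q] ∧ m.Coprime Q),
        polyRootWeylSum (C ((Q : ℤ) ^ 2) * X ^ 2 - C D) m h‖ ≤
          K * (Q : ℝ) ^ A * |(h : ℝ)| ^ A * (M : ℝ) ^ (1 - η))
    {a b c₀ : ℤ} (ha : a ≠ 0) (hD : discrim a b c₀ = D) (hΔ : D ≠ 0)
    {q b₁ : ℕ} (hq : 0 < q) (hb₁ : b₁ < q) {h : ℤ} (hh0 : h ≠ 0) {x L : ℕ} (hL : L ≠ 0)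
    {E₀ : ℝ} (hE₀ : 1 ≤ E₀) {e : ℕ}
    (he : e ∈ ((Icc 1 x).filter (fun n : ℕ => L ∣ n ∧
      n.Coprime (q * (2 * a * D).natAbs))).image (fun n => Nat.gcd n (L ^ n)))
    (heE : (e : ℝ) ≤ E₀) :
    ‖∑ n ∈ ((Icc 1 x).filter (fun n : ℕ => L ∣ n ∧
        n.Coprime (q * (2 * a * D).natAbs))).filter (fun n => Nat.gcd n (L ^ n) = e),
        polyRootWeylSum ((C a * X ^ 2 + C b * X + C c₀).comp (C (q : ℤ) * X + C (b₁ : ℤ))) n h‖ ≤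
      8 * (1 + |(b : ℝ)|) * K * |(D : ℝ)| ^ A *
        ((q * (2 * a * D).natAbs : ℕ) : ℝ) ^ (A + 1) * E₀ ^ (A + 2) *
        |(h : ℝ)| ^ (A + 1) * (x : ℝ) ^ (1 - η) := by
  obtain ⟨he1, hex, -, heQ, -⟩ := of_mem_image_gcd_pow hL he
  have h2aΔ : 2 * a * D ≠ 0 := mul_ne_zero (mul_ne_zero two_ne_zero ha) hΔ
  set B : ℕ := (2 * a * D).natAbs with hBdef
  have hB0 : B ≠ 0 := by rw [hBdef]; exact Int.natAbs_ne_zero.mpr h2aΔ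
  have he0 : 0 < e := he1
  set hh : ℤ := h * Int.sign (2 * a * D) * D with hhh_def
  have hhh : hh ≠ 0 :=
    mul_ne_zero (mul_ne_zero hh0 (Int.sign_eq_zero_iff_zero.not.mpr h2aΔ)) hΔ
  rw [sum_fiber_gcd_pow_eq _ hL he]
  set T : ℕ := q * B * e with hTdef
  refine (norm_sum_fiber_le hη2 hK0 HB a b c₀ hD q b₁ e h hq hB0 he0 hhh hTdef (x / e)).trans ?_
  -- the factors
  have hQ1 : (1 : ℝ) ≤ ((q * B : ℕ) : ℝ) := by
    have : 1 ≤ q * B := Nat.one_le_iff_ne_zero.mpr (Nat.mul_ne_zero hq.ne' hB0)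
    exact_mod_cast this
  have hT : (T : ℝ) = ((q * B : ℕ) : ℝ) * e := by rw [hTdef]; push_cast; ring
  have hTle : (T : ℝ) ≤ ((q * B : ℕ) : ℝ) * E₀ := by
    rw [hT]; exact mul_le_mul_of_nonneg_left heE (by positivity)
  have hT0 : (0 : ℝ) ≤ (T : ℝ) := Nat.cast_nonneg _
  have hh1 : (1 : ℝ) ≤ |(h : ℝ)| := by rw [← Int.cast_abs]; exact_mod_cast Int.one_le_abs hh0
  have hx' : (((x / e : ℕ)) : ℝ) ≤ x := by exact_mod_cast Nat.div_le_self x e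
  have hhabs : |(hh : ℝ)| = |(h : ℝ)| * |(D : ℝ)| := by
    rw [hhh_def]; push_cast
    rw [abs_mul, abs_mul, ← Int.cast_abs (a := Int.sign _), Int.abs_sign_of_ne_zero h2aΔ]
    push_cast; ring
  have h1 := one_add_phase_coeff_le (b := b) ha hΔ hq hb₁ he0 hh0
  have h2 : K * (T : ℝ) ^ A * |(hh : ℝ)| ^ A * (((x / e : ℕ)) : ℝ) ^ (1 - η) ≤
      K * (((q * B : ℕ) : ℝ) * E₀) ^ A * (|(h : ℝ)| * |(D : ℝ)|) ^ A *
        (x : ℝ) ^ (1 - η) := by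
    rw [hhabs]
    refine mul_le_mul (mul_le_mul_of_nonneg_right (mul_le_mul_of_nonneg_left
      (Real.rpow_le_rpow hT0 hTle hA0) hK0) (by positivity))
      (Real.rpow_le_rpow (Nat.cast_nonneg _) hx' (by linarith)) (by positivity) (by positivity)
  calc (T : ℝ) * e * (1 + 2 * Real.pi *
          |((h * Int.sign (2 * a * D) * D * (2 * a * b₁ + b) : ℤ) : ℝ)| / (T : ℝ)) *
        (K * (T : ℝ) ^ A * |(hh : ℝ)| ^ A * (((x / e : ℕ)) : ℝ) ^ (1 - η))
      ≤ (((q * B : ℕ) : ℝ) * E₀) * E₀ * (8 * (1 + |(b : ℝ)|) * |(h : ℝ)|) *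
        (K * (((q * B : ℕ) : ℝ) * E₀) ^ A * (|(h : ℝ)| * |(D : ℝ)|) ^ A *
          (x : ℝ) ^ (1 - η)) := by
        refine mul_le_mul (mul_le_mul (mul_le_mul hTle heE (by positivity) (by positivity)) h1
          (by positivity) (by positivity)) h2 (by positivity) (by positivity)
    _ = 8 * (1 + |(b : ℝ)|) * K * |(D : ℝ)| ^ A *
        ((q * B : ℕ) : ℝ) ^ (A + 1) * E₀ ^ (A + 2) * |(h : ℝ)| ^ (A + 1) * (x : ℝ) ^ (1 - η) := by
        have hE0 : (0 : ℝ) ≤ E₀ := by linarith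
        rw [Real.mul_rpow (by positivity) hE0, Real.mul_rpow (by positivity) (by positivity),
          Real.rpow_add_one (by positivity) A, Real.rpow_add_one (by positivity) A,
          show A + 2 = A + 1 + 1 by ring, Real.rpow_add_one (by positivity) (A + 1),
          Real.rpow_add_one (by positivity) A]
        ring

/-- **Large `L`-parts (trivial bound).**  For `e` in the image of the `L`-part:
`|∑_{fibre of e} S_G(h; n)| ≤ C₄ · L · C_ρ · x / e`, `G = g(qX + b₁)` (`ρ_G(en') = ρ_G(e)ρ_G(n')`,
`ρ_G(e) = ρ_g(e) ≤ C₄ 2^{ω(e)} ≤ C₄ L`, `∑_{n' ≤ x/e, (n',Q)=1} ρ_G(n') ≤ C_ρ x/e`). [folklore] -/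
theorem norm_sum_large_fiber_le {g : ℤ[X]} {C₄ : ℕ}
    (hC₄ : ∀ k : ℕ, polyRootCountMod ![g] k ≤ C₄ * g.natDegree ^ k.primeFactors.card)
    (hdeg : g.natDegree = 2) {Cρ : ℝ} {q b₁ : ℕ} {Q : ℕ}
    (hρ : ∀ k : ℕ, ∑ n ∈ Icc 1 k, (((if n.Coprime Q then
      TypeIFromWeyl.rootSet (g.comp (C (q : ℤ) * X + C (b₁ : ℤ))) n else ∅).card : ℕ) : ℝ) ≤ Cρ * k)
    (hqQ : q ∣ Q) (h : ℤ) {x L : ℕ} (hL : L ≠ 0) {e : ℕ}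
    (he : e ∈ ((Icc 1 x).filter (fun n : ℕ => L ∣ n ∧ n.Coprime Q)).image
      (fun n => Nat.gcd n (L ^ n))) :
    ‖∑ n ∈ ((Icc 1 x).filter (fun n : ℕ => L ∣ n ∧ n.Coprime Q)).filter
        (fun n => Nat.gcd n (L ^ n) = e), polyRootWeylSum (g.comp (C (q : ℤ) * X + C (b₁ : ℤ))) n h‖ ≤
      C₄ * L * Cρ * x / e := by
  obtain ⟨he1, hex, -, heQ, hepf⟩ := of_mem_image_gcd_pow hL he
  have he0 : 0 < e := he1
  have her : (0 : ℝ) < e := by exact_mod_cast he0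
  set G := g.comp (C (q : ℤ) * X + C (b₁ : ℤ)) with hG
  -- pass to `ρ_G`
  have h1 : ‖∑ n ∈ ((Icc 1 x).filter (fun n : ℕ => L ∣ n ∧ n.Coprime Q)).filter
      (fun n => Nat.gcd n (L ^ n) = e), polyRootWeylSum G n h‖ ≤
      ∑ n ∈ ((Icc 1 x).filter (fun n : ℕ => L ∣ n ∧ n.Coprime Q)).filter
        (fun n => Nat.gcd n (L ^ n) = e), (polyRootCountMod ![G] n : ℝ) :=
    (norm_sum_le _ _).trans (Finset.sum_le_sum fun n _ => norm_polyRootWeylSum_le _ _ _)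
  refine h1.trans ?_
  rw [sum_fiber_gcd_pow_eq (fun n => (polyRootCountMod ![G] n : ℝ)) hL he]
  -- multiplicativity
  have h2 : ∀ n' ∈ (Icc 1 (x / e)).filter (fun n' : ℕ => n'.Coprime (Q * e)),
      (polyRootCountMod ![G] (e * n') : ℝ) =
        (polyRootCountMod ![G] e : ℝ) * (((if n'.Coprime Q then
          TypeIFromWeyl.rootSet G n' else ∅).card : ℕ) : ℝ) := by
    intro n' hn'
    rw [Finset.mem_filter] at hn'
    have hcop : e.Coprime n' := (Nat.Coprime.coprime_dvd_right (dvd_mul_left e Q) hn'.2).symm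
    rw [polyRootCountMod_mul_of_coprime _ hcop, if_pos (Nat.Coprime.coprime_dvd_right
      (dvd_mul_right Q e) hn'.2), TypeIFromWeyl.card_rootSet]
    push_cast; ring
  rw [Finset.sum_congr rfl h2, ← Finset.mul_sum]
  -- the two factors
  have hρe : (polyRootCountMod ![G] e : ℝ) ≤ C₄ * L := by
    have hqe : q.Coprime e := (Nat.Coprime.coprime_dvd_right hqQ heQ).symm
    have h3 : polyRootCountMod ![G] e = polyRootCountMod ![g] e := by
      rw [← TypeIFromWeyl.card_rootSet, ← TypeIFromWeyl.card_rootSet, hG,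
        TypeIFromWeyl.card_rootSet_comp_eq _ he0 hqe]
    rw [h3]
    refine le_trans (b := ((C₄ * 2 ^ L.primeFactors.card : ℕ) : ℝ)) ?_ ?_
    · have h4 := hC₄ e
      rw [hdeg] at h4
      exact_mod_cast h4.trans (Nat.mul_le_mul_left _
        (pow_le_pow_right₀ (by norm_num) (Finset.card_le_card hepf)))
    · have h5 : 2 ^ L.primeFactors.card ≤ L :=
        (Finset.pow_card_le_prod _ _ 2 fun _ hp => (Nat.prime_of_mem_primeFactors hp).two_le).trans
          (Nat.le_of_dvd (Nat.pos_of_ne_zero hL) (Nat.prod_primeFactors_dvd L))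
      exact_mod_cast Nat.mul_le_mul_left _ h5
  have hsum : ∑ n' ∈ (Icc 1 (x / e)).filter (fun n' : ℕ => n'.Coprime (Q * e)),
      (((if n'.Coprime Q then TypeIFromWeyl.rootSet G n' else ∅).card : ℕ) : ℝ) ≤ Cρ * x / e := by
    calc _ ≤ ∑ n' ∈ Icc 1 (x / e),
          (((if n'.Coprime Q then TypeIFromWeyl.rootSet G n' else ∅).card : ℕ) : ℝ) :=
          Finset.sum_le_sum_of_subset_of_nonneg (Finset.filter_subset _ _)
            fun _ _ _ => Nat.cast_nonneg _
      _ ≤ Cρ * ((x / e : ℕ) : ℝ) := hρ (x / e)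
      _ ≤ Cρ * x / e := by
          have hCρ : 0 ≤ Cρ := by
            have := hρ 1
            rw [Finset.Icc_self, Finset.sum_singleton] at this
            have h0 : (0 : ℝ) ≤ (((if (1 : ℕ).Coprime Q then TypeIFromWeyl.rootSet G 1 else ∅).card
              : ℕ) : ℝ) := Nat.cast_nonneg _
            push_cast at this; linarith
          rw [mul_div_assoc]
          exact mul_le_mul_of_nonneg_left Nat.cast_div_le hCρ
  have hs0 : 0 ≤ ∑ n' ∈ (Icc 1 (x / e)).filter (fun n' : ℕ => n'.Coprime (Q * e)),
      (((if n'.Coprime Q then TypeIFromWeyl.rootSet G n' else ∅).card : ℕ) : ℝ) :=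
    Finset.sum_nonneg fun _ _ => Nat.cast_nonneg _
  calc (polyRootCountMod ![G] e : ℝ) * _ ≤ (C₄ * L) * (Cρ * x / e) :=
        mul_le_mul hρe hsum hs0 (by positivity)
    _ = _ := by ring

/-- **The uniform level Weyl bound.**  Let `g = aX² + bX + c₀ ∈ ℤ[X]` be irreducible with
`Δ = b² − 4ac₀ ≠ 0`, and suppose the CLASS BOUND for the dilates of `X² − Δ`:
`|∑_{m ≤ M, m ≡ u (Q), (m,Q)=1} S_{Q²X²−Δ}(h; m)| ≤ K Q^A |h|^A M^{1−η}` for all `Q ≥ 1`, `u`,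
`h ≠ 0`, `M` (`0 < η ≤ 1/2`, `A ≥ 0`, `K ≥ 1`).  Then there are `K_w ≥ 0`, `A_q > 0`, `C_w ≥ 0`,
`δ₀ ∈ (0, 1]` with
`|∑_{n ≤ x, L ∣ n, (n, q|2aΔ|) = 1} S_{g(qX+b₁)}(h; n)| ≤ K_w q^{A_q} (1+|h|)^{C_w} L^{C_w} x^{1−δ₀}`
for all `q ≥ 1`, `b₁ < q`, `x`, `L ≥ 1`, `h ≠ 0` (split `n = e n'` along the `L`-part `e`;
`norm_sum_small_fiber_le` for `e ≤ x^κ`, `norm_sum_large_fiber_le` and Rankin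
`sum_rpow_neg_half_le` for `e > x^κ`, `κ = η/(2(A+3))`; one gets `A_q = A + 1`, `C_w = A + 3`,
`δ₀ = η/(4(A+3))`). [folklore] -/
theorem weylLevelBound_uniform {a b c₀ : ℤ} (ha : a ≠ 0)
    (hirr : Irreducible (C a * X ^ 2 + C b * X + C c₀)) (hΔ0 : discrim a b c₀ ≠ 0)
    {η A K : ℝ} (hη0 : 0 < η) (hη2 : η ≤ 1 / 2) (hA0 : 0 ≤ A) (hK1 : 1 ≤ K)
    (HB : ∀ (Q u : ℕ) (h : ℤ) (M : ℕ), 0 < Q → h ≠ 0 →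
      ‖∑ m ∈ (Icc 1 M).filter (fun m : ℕ => m ≡ u [MOD Q] ∧ m.Coprime Q),
        polyRootWeylSum (C ((Q : ℤ) ^ 2) * X ^ 2 - C (discrim a b c₀)) m h‖ ≤
          K * (Q : ℝ) ^ A * |(h : ℝ)| ^ A * (M : ℝ) ^ (1 - η)) :
    ∃ Kw Aq Cw δ₀ : ℝ, 0 ≤ Kw ∧ 0 < Aq ∧ 0 ≤ Cw ∧ 0 < δ₀ ∧ δ₀ ≤ 1 ∧
      ∀ q b₁ : ℕ, 1 ≤ q → b₁ < q → ∀ x L : ℕ, 1 ≤ L → ∀ h : ℤ, h ≠ 0 →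
        ‖∑ n ∈ (Icc 1 x).filter (fun n : ℕ => L ∣ n ∧
            n.Coprime (q * (2 * a * discrim a b c₀).natAbs)),
            polyRootWeylSum ((C a * X ^ 2 + C b * X + C c₀).comp (C (q : ℤ) * X + C (b₁ : ℤ)))
              n h‖ ≤
          Kw * (q : ℝ) ^ Aq * (1 + |(h : ℝ)|) ^ Cw * (L : ℝ) ^ Cw * (x : ℝ) ^ (1 - δ₀) := by
  obtain ⟨D, hD⟩ : ∃ D : ℤ, discrim a b c₀ = D := ⟨_, rfl⟩
  rw [hD] at HB hΔ0 ⊢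
  have hΔ : D ≠ 0 := hΔ0
  have h2aΔ : 2 * a * D ≠ 0 := mul_ne_zero (mul_ne_zero two_ne_zero ha) hΔ
  have hK0 : 0 ≤ K := by linarith
  have hη1 : η ≤ 1 := by linarith
  -- Hooley's Lemma 4 and the mean value of `ρ`
  have hdeg : (C a * X ^ 2 + C b * X + C c₀).natDegree = 2 := natDegree_quadratic ha
  obtain ⟨C₄, -, hC₄⟩ := exists_polyRootCountMod_le_mul_pow_card_primeFactors hirr
    (by rw [hdeg]; norm_num)
  have hprim : (C a * X ^ 2 + C b * X + C c₀).IsPrimitive := hirr.isPrimitive (by rw [hdeg]; decide)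
  have hirrQ : Irreducible ((C a * X ^ 2 + C b * X + C c₀).map (Int.castRingHom ℚ)) := by
    rw [← algebraMap_int_eq]
    exact (hprim.irreducible_iff_irreducible_map_fraction_map (K := ℚ)).mp hirr
  obtain ⟨Cρ, hCρ, hρ⟩ := TypeIFromWeyl.exists_sum_card_roots_le _ hirrQ (by rw [hdeg]; norm_num)
  have hcont : ∀ Q : ℕ, ∀ p : ℕ, p.Prime → (p : ℤ) ∣ (C a * X ^ 2 + C b * X + C c₀).content → p ∣ Q := by
    intro Q p hp hpc
    rw [hprim.content_eq_one] at hpc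
    have := Int.eq_one_of_dvd_one (by positivity) hpc
    exact absurd (by exact_mod_cast this) hp.ne_one
  set B : ℕ := (2 * a * D).natAbs with hBdef
  have hB0 : B ≠ 0 := by rw [hBdef]; exact Int.natAbs_ne_zero.mpr h2aΔ
  -- the constants
  set c₁ : ℝ := 8 * (1 + |(b : ℝ)|) * K * |(D : ℝ)| ^ A * (B : ℝ) ^ (A + 1) with hc₁
  have hc₁0 : 0 ≤ c₁ := by rw [hc₁]; positivity
  have hA3 : (0 : ℝ) < A + 3 := by linarith
  refine ⟨c₁ + C₄ * Cρ, A + 1, A + 3, η / (4 * (A + 3)), by positivity, by linarith, by linarith,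
    by positivity, ?_, ?_⟩
  · rw [div_le_one (by positivity)]; nlinarith
  intro q b₁ hq hb₁ x L hL h hh0
  rcases Nat.eq_zero_or_pos x with rfl | hx
  · rw [show Icc 1 0 = (∅ : Finset ℕ) by rfl, Finset.filter_empty, Finset.sum_empty, norm_zero]
    positivity
  have hx1 : (1 : ℝ) ≤ x := by exact_mod_cast hx
  have hx0 : (0 : ℝ) < x := by linarith
  have hq1 : (1 : ℝ) ≤ q := by exact_mod_cast hq
  have hL1 : (1 : ℝ) ≤ L := by exact_mod_cast hL
  have hL0 : L ≠ 0 := by omega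
  have hh1 : (1 : ℝ) ≤ 1 + |(h : ℝ)| := by have := abs_nonneg (h : ℝ); linarith
  have habs1 : (1 : ℝ) ≤ |(h : ℝ)| := by rw [← Int.cast_abs]; exact_mod_cast Int.one_le_abs hh0
  -- the parameter `E₀ = x^κ`
  set κ : ℝ := η / (2 * (A + 3)) with hκ
  have hκ0 : 0 < κ := by rw [hκ]; positivity
  set E₀ : ℝ := (x : ℝ) ^ κ with hE₀
  have hE₀1 : 1 ≤ E₀ := Real.one_le_rpow hx1 hκ0.le
  have hE₀0 : 0 < E₀ := by linarith
  set S := (Icc 1 x).filter (fun n : ℕ => L ∣ n ∧ n.Coprime (q * B)) with hS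
  set img := S.image (fun n => Nat.gcd n (L ^ n)) with himg
  rw [sum_level_eq_sum_image]
  refine (norm_sum_le _ _).trans ?_
  rw [← Finset.sum_filter_add_sum_filter_not img (fun e : ℕ => (e : ℝ) ≤ E₀)]
  -- ## small `L`-parts
  set M₀ : ℝ := 8 * (1 + |(b : ℝ)|) * K * |(D : ℝ)| ^ A *
    ((q * B : ℕ) : ℝ) ^ (A + 1) * E₀ ^ (A + 2) * |(h : ℝ)| ^ (A + 1) * (x : ℝ) ^ (1 - η) with hM₀
  have hM₀0 : 0 ≤ M₀ := by rw [hM₀]; positivity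
  have hsmall : ∑ e ∈ img.filter (fun e : ℕ => (e : ℝ) ≤ E₀),
      ‖∑ n ∈ S.filter (fun n => Nat.gcd n (L ^ n) = e),
        polyRootWeylSum ((C a * X ^ 2 + C b * X + C c₀).comp (C (q : ℤ) * X + C (b₁ : ℤ))) n h‖ ≤
      E₀ * M₀ := by
    calc _ ≤ ∑ e ∈ img.filter (fun e : ℕ => (e : ℝ) ≤ E₀), M₀ := by
          refine Finset.sum_le_sum fun e he => ?_
          rw [Finset.mem_filter] at he
          exact norm_sum_small_fiber_le hη1 hA0 hK0 HB ha hD hΔ hq hb₁ hh0 hL0 hE₀1 he.1 he.2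
      _ = ((img.filter (fun e : ℕ => (e : ℝ) ≤ E₀)).card : ℝ) * M₀ := by
          rw [Finset.sum_const, nsmul_eq_mul]
      _ ≤ E₀ * M₀ := by
          refine mul_le_mul_of_nonneg_right ?_ hM₀0
          have hsub : img.filter (fun e : ℕ => (e : ℝ) ≤ E₀) ⊆ Icc 1 ⌊E₀⌋₊ := by
            intro e he
            rw [Finset.mem_filter] at he
            rw [Finset.mem_Icc]
            exact ⟨(of_mem_image_gcd_pow hL0 he.1).1, Nat.le_floor he.2⟩
          have h1 := Finset.card_le_card hsub
          rw [Nat.card_Icc, Nat.add_sub_cancel] at h1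
          calc ((img.filter (fun e : ℕ => (e : ℝ) ≤ E₀)).card : ℝ) ≤ ⌊E₀⌋₊ := by exact_mod_cast h1
            _ ≤ E₀ := Nat.floor_le hE₀0.le
  -- ## large `L`-parts
  have hlarge : ∑ e ∈ img.filter (fun e : ℕ => ¬ (e : ℝ) ≤ E₀),
      ‖∑ n ∈ S.filter (fun n => Nat.gcd n (L ^ n) = e),
        polyRootWeylSum ((C a * X ^ 2 + C b * X + C c₀).comp (C (q : ℤ) * X + C (b₁ : ℤ))) n h‖ ≤
      C₄ * L * Cρ * x * (E₀ ^ (-(1 / 2 : ℝ)) * (L : ℝ) ^ 2) := by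
    have hterm : ∀ e ∈ img.filter (fun e : ℕ => ¬ (e : ℝ) ≤ E₀),
        ‖∑ n ∈ S.filter (fun n => Nat.gcd n (L ^ n) = e),
          polyRootWeylSum ((C a * X ^ 2 + C b * X + C c₀).comp (C (q : ℤ) * X + C (b₁ : ℤ))) n h‖ ≤
        C₄ * L * Cρ * x * (E₀ ^ (-(1 / 2 : ℝ)) * (e : ℝ) ^ (-(1 / 2 : ℝ))) := by
      intro e he
      rw [Finset.mem_filter, not_le] at he
      have he1 := (of_mem_image_gcd_pow hL0 he.1).1
      have her : (0 : ℝ) < e := by exact_mod_cast he1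
      have h1 := norm_sum_large_fiber_le (g := C a * X ^ 2 + C b * X + C c₀) hC₄ hdeg (hρ q b₁ (q * B) (fun p _ hp => hp.mul_right B)
        (hcont (q * B))) (dvd_mul_right q B) h hL0 he.1
      refine h1.trans ?_
      -- `x/e ≤ x E₀^{-1/2} e^{-1/2}` for `e > E₀`
      have h2 : (1 : ℝ) / e = (e : ℝ) ^ (-(1 / 2 : ℝ)) * (e : ℝ) ^ (-(1 / 2 : ℝ)) := by
        rw [← Real.rpow_add her]; norm_num
        rw [Real.rpow_neg_one]
      have h3 : (e : ℝ) ^ (-(1 / 2 : ℝ)) ≤ E₀ ^ (-(1 / 2 : ℝ)) :=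
        Real.rpow_le_rpow_of_nonpos hE₀0 he.2.le (by norm_num)
      have key : (x : ℝ) / e ≤ x * (E₀ ^ (-(1 / 2 : ℝ)) * (e : ℝ) ^ (-(1 / 2 : ℝ))) :=
        calc (x : ℝ) / e = x * (1 / e) := by ring
          _ = x * ((e : ℝ) ^ (-(1 / 2 : ℝ)) * (e : ℝ) ^ (-(1 / 2 : ℝ))) := by rw [h2]
          _ ≤ x * (E₀ ^ (-(1 / 2 : ℝ)) * (e : ℝ) ^ (-(1 / 2 : ℝ))) :=
              mul_le_mul_of_nonneg_left (mul_le_mul_of_nonneg_right h3 (by positivity))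
                (by positivity)
      calc (C₄ : ℝ) * L * Cρ * x / e = C₄ * L * Cρ * ((x : ℝ) / e) := by ring
        _ ≤ C₄ * L * Cρ * (x * (E₀ ^ (-(1 / 2 : ℝ)) * (e : ℝ) ^ (-(1 / 2 : ℝ)))) :=
            mul_le_mul_of_nonneg_left key (by positivity)
        _ = _ := by ring
    refine (Finset.sum_le_sum hterm).trans ?_
    rw [← Finset.mul_sum, ← Finset.mul_sum]
    refine mul_le_mul_of_nonneg_left (mul_le_mul_of_nonneg_left ?_ (by positivity)) (by positivity)
    calc ∑ e ∈ img.filter (fun e : ℕ => ¬ (e : ℝ) ≤ E₀), (e : ℝ) ^ (-(1 / 2 : ℝ))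
        ≤ ∑ e ∈ img, (e : ℝ) ^ (-(1 / 2 : ℝ)) :=
          Finset.sum_le_sum_of_subset_of_nonneg (Finset.filter_subset _ _)
            fun e _ _ => Real.rpow_nonneg (Nat.cast_nonneg _) _
      _ ≤ (L : ℝ) ^ 2 := sum_rpow_neg_half_le hL0 fun e he =>
          ⟨by have := (of_mem_image_gcd_pow hL0 he).1; omega, (of_mem_image_gcd_pow hL0 he).2.2.2.2⟩
  refine (add_le_add hsmall hlarge).trans ?_
  -- ## numerics
  have hmul : ∀ u v : ℝ, (x : ℝ) ^ u * (x : ℝ) ^ v = (x : ℝ) ^ (u + v) := fun u v =>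
    (Real.rpow_add hx0 u v).symm
  have hrle : ∀ {u v : ℝ}, u ≤ v → (x : ℝ) ^ u ≤ (x : ℝ) ^ v := fun h =>
    Real.rpow_le_rpow_of_exponent_le hx1 h
  -- (1) the small part
  have hE₀pow : E₀ * E₀ ^ (A + 2) = (x : ℝ) ^ (η / 2) := by
    rw [show E₀ * E₀ ^ (A + 2) = E₀ ^ (A + 2) * E₀ by ring, ← Real.rpow_add_one hE₀0.ne',
      hE₀, ← Real.rpow_mul hx0.le]
    congr 1
    rw [hκ]; field_simp; ring
  have hqB : ((q * B : ℕ) : ℝ) ^ (A + 1) = (q : ℝ) ^ (A + 1) * (B : ℝ) ^ (A + 1) := by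
    push_cast; exact Real.mul_rpow (by positivity) (by positivity)
  have hT1 : E₀ * M₀ ≤ c₁ * ((q : ℝ) ^ (A + 1) * (1 + |(h : ℝ)|) ^ (A + 3) * (L : ℝ) ^ (A + 3) *
      (x : ℝ) ^ (1 - η / (4 * (A + 3)))) := by
    have heq : E₀ * M₀ = c₁ * ((q : ℝ) ^ (A + 1) * |(h : ℝ)| ^ (A + 1) * 1 *
        (x : ℝ) ^ (1 - η / 2)) := by
      have : (x : ℝ) ^ (1 - η / 2) = (x : ℝ) ^ (η / 2) * (x : ℝ) ^ (1 - η) := by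
        rw [hmul]; congr 1; ring
      rw [this, ← hE₀pow, hM₀, hqB, hc₁]; ring
    rw [heq]
    refine mul_le_mul_of_nonneg_left ?_ hc₁0
    refine mul_le_mul (mul_le_mul (mul_le_mul_of_nonneg_left ?_ (by positivity)) ?_ zero_le_one
      (by positivity)) (hrle ?_) (by positivity) (by positivity)
    · calc |(h : ℝ)| ^ (A + 1) ≤ (1 + |(h : ℝ)|) ^ (A + 1) :=
            Real.rpow_le_rpow (abs_nonneg _) (by linarith) (by linarith)
        _ ≤ (1 + |(h : ℝ)|) ^ (A + 3) := Real.rpow_le_rpow_of_exponent_le hh1 (by linarith)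
    · exact Real.one_le_rpow hL1 (by linarith)
    · have : η / (4 * (A + 3)) ≤ η / 2 := by
        rw [div_le_div_iff₀ (by positivity) (by positivity)]; nlinarith
      linarith
  -- (2) the large part
  have hE₀neg : E₀ ^ (-(1 / 2 : ℝ)) = (x : ℝ) ^ (-(η / (4 * (A + 3)))) := by
    rw [hE₀, ← Real.rpow_mul hx0.le]
    congr 1
    rw [hκ]; field_simp; ring
  have hT2 : (C₄ : ℝ) * L * Cρ * x * (E₀ ^ (-(1 / 2 : ℝ)) * (L : ℝ) ^ 2) ≤
      C₄ * Cρ * ((q : ℝ) ^ (A + 1) * (1 + |(h : ℝ)|) ^ (A + 3) * (L : ℝ) ^ (A + 3) *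
        (x : ℝ) ^ (1 - η / (4 * (A + 3)))) := by
    have heq : (C₄ : ℝ) * L * Cρ * x * (E₀ ^ (-(1 / 2 : ℝ)) * (L : ℝ) ^ 2) =
        C₄ * Cρ * (1 * 1 * (L : ℝ) ^ (3 : ℝ) * (x : ℝ) ^ (1 - η / (4 * (A + 3)))) := by
      have h1 : (x : ℝ) ^ (1 - η / (4 * (A + 3))) = x * (x : ℝ) ^ (-(η / (4 * (A + 3)))) := by
        rw [sub_eq_add_neg, Real.rpow_add hx0, Real.rpow_one]
      have h2 : (L : ℝ) ^ (3 : ℝ) = L * (L : ℝ) ^ 2 := by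
        rw [show (3 : ℝ) = ((3 : ℕ) : ℝ) by norm_num, Real.rpow_natCast]; ring
      rw [h1, h2, hE₀neg]; ring
    rw [heq]
    refine mul_le_mul_of_nonneg_left ?_ (by positivity)
    refine mul_le_mul_of_nonneg_right (mul_le_mul (mul_le_mul ?_ ?_ zero_le_one (by positivity))
      ?_ (by positivity) (by positivity)) (by positivity)
    · exact Real.one_le_rpow hq1 (by linarith)
    · exact Real.one_le_rpow hh1 (by linarith)
    · exact Real.rpow_le_rpow_of_exponent_le hL1 (by linarith)
  refine (add_le_add hT1 hT2).trans (le_of_eq ?_)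
  ring



/-! ### Type-I information, uniformly in the progression modulus -/

set_option maxHeartbeats 1600000 in
/-- **Type-I information, uniformly in the progression modulus** (the argument of the tree's
`TypeIFromWeyl.typeI_of_weylLevelBound`, Hooley 1967 §3, with the constant tracked).  Let
`P ∈ ℤ[X]` be irreducible over `ℚ` of positive degree, `B ≠ 0` a modulus containing the primes of
`cont P`, and suppose the level Weyl bound
`|∑_{n ≤ x, L ∣ n, (n, qB) = 1} S_{P(qX+b₁)}(h; n)| ≤ K_w q^{A_q} (1+|h|)^{C} L^{C} x^{1−δ₀}` for all
`q ≥ 1`, `b₁ < q`, `x`, `L ≥ 1`, `h ≠ 0`.  Then for `0 < ε`, `ε(20 + 6C) ≤ δ₀` there are `K, y₀`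
(depending on `P, B, K_w, C, ε` only) with
`|∑_{N₁<n≤N₂, ℓ∣n, (n,qB)=1} (#{y<t≤2y : t ≡ b₀ (q), n ∣ P(t)} − (y/q)ρ_P(n)/n)| ≤ K q^{A_q} y^{1−ε}`
for all `y ≥ y₀`, `1 ≤ q ≤ y`, `b₀`, `1 ≤ ℓ ≤ y^ε`, `N₁ ≤ N₂ ≤ y^{1+ε}`: the constant of the
tree's theorem is `9C_ρ + 1872·2^{C}·K_W`, linear in the Weyl constant `K_W = K_w q^{A_q}`, and
its `y₀` depends on `q` only through `q ≤ y`.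
[cite: Hooley1967, §§3–6 (the method, for `n² − D`)] -/
theorem typeI_of_weylLevelBound_uniform (P : ℤ[X]) (hirr : Irreducible (P.map (Int.castRingHom ℚ)))
    (hdeg : 0 < P.natDegree) {B : ℕ}
    (hcB : ∀ p : ℕ, p.Prime → (p : ℤ) ∣ P.content → p ∣ B)
    {δ₀ Cw Kw Aq : ℝ} (hδ₁ : δ₀ ≤ 1) (hC : 0 ≤ Cw) (hKw : 0 ≤ Kw) (hAq : 0 ≤ Aq)
    (HWL : ∀ q b₁ : ℕ, 1 ≤ q → b₁ < q → ∀ x L : ℕ, 1 ≤ L → ∀ h : ℤ, h ≠ 0 →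
      ‖∑ n ∈ (Finset.Icc 1 x).filter (fun n => L ∣ n ∧ n.Coprime (q * B)),
          polyRootWeylSum (P.comp (C (q : ℤ) * X + C (b₁ : ℤ))) n h‖ ≤
        Kw * (q : ℝ) ^ Aq * (1 + |(h : ℝ)|) ^ Cw * (L : ℝ) ^ Cw * (x : ℝ) ^ (1 - δ₀))
    {ε : ℝ} (hε : 0 < ε) (hεδ : ε * (20 + 6 * Cw) ≤ δ₀) :
    ∃ (K : ℝ) (y₀ : ℕ), ∀ y : ℕ, y₀ ≤ y → ∀ q b₀ : ℕ, 1 ≤ q → q ≤ y →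
      ∀ ℓ N₁ N₂ : ℕ, 1 ≤ ℓ → (ℓ : ℝ) ≤ (y : ℝ) ^ ε → N₁ ≤ N₂ → (N₂ : ℝ) ≤ (y : ℝ) ^ (1 + ε) →
        |∑ n ∈ (Finset.Ioc N₁ N₂).filter (fun n => ℓ ∣ n ∧ n.Coprime (q * B)),
            ((((Finset.Ioc y (2 * y)).filter (fun t : ℕ => t % q = b₀ % q ∧
                (n : ℤ) ∣ P.eval (t : ℤ))).card : ℝ) -
              (y : ℝ) / q * (polyRootCountMod ![P] n : ℝ) / n)| ≤
          K * (q : ℝ) ^ Aq * (y : ℝ) ^ (1 - ε) := by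
  classical
  obtain ⟨Cρ, hCρ, hρsum⟩ := TypeIFromWeyl.exists_sum_card_roots_le P hirr hdeg
  have hδ₀ : 0 < δ₀ := lt_of_lt_of_le (by positivity) hεδ
  have hε20 : 20 * ε ≤ δ₀ := by nlinarith
  have hε7 : 7 * ε < 1 := by linarith
  -- largeness (independent of `q`)
  have e2 : ∀ᶠ y : ℕ in Filter.atTop, (2 : ℝ) ≤ (y : ℝ) ^ (1 - 2 * ε) :=
    TypeIFromWeyl.eventually_nat_le_rpow' (by linarith) _
  have e3 : ∀ᶠ y : ℕ in Filter.atTop, (2 : ℝ) ≤ (y : ℝ) ^ (1 - 7 * ε) :=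
    TypeIFromWeyl.eventually_nat_le_rpow' (by linarith) _
  have e4 : ∀ᶠ y : ℕ in Filter.atTop, (16 : ℝ) ≤ (y : ℝ) ^ (5 * ε) :=
    TypeIFromWeyl.eventually_nat_le_rpow' (by positivity) _
  obtain ⟨y₀, hy₀⟩ := Filter.eventually_atTop.mp (e2.and (e3.and e4))
  refine ⟨9 * Cρ + 1872 * (2 : ℝ) ^ Cw * Kw, max y₀ 1,
    fun y hy q b₀ hq hyq ℓ N₁ N₂ hℓ hℓy hN12 hN₂ => ?_⟩
  obtain ⟨hy2, hy3, hy4⟩ := hy₀ y (le_trans (le_max_left _ _) hy)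
  -- the data depending on `q`
  have hqQ : ∀ p : ℕ, p.Prime → p ∣ q → p ∣ q * B := fun p _ hp => hp.mul_right B
  have hcQ : ∀ p : ℕ, p.Prime → (p : ℤ) ∣ P.content → p ∣ q * B :=
    fun p hp hpc => (hcB p hp hpc).mul_left q
  have hb₁q : b₀ % q < q := Nat.mod_lt _ hq
  set KW' : ℝ := Kw * (q : ℝ) ^ Aq with hKW'
  have hKW0 : 0 ≤ KW' := by rw [hKW']; positivity
  have hWL : ∀ x L : ℕ, 1 ≤ L → ∀ h : ℤ, h ≠ 0 →
      ‖∑ n ∈ (Finset.Icc 1 x).filter (fun n => L ∣ n ∧ n.Coprime (q * B)),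
        polyRootWeylSum (P.comp (C (q : ℤ) * X + C ((b₀ % q : ℕ) : ℤ))) n h‖ ≤
        KW' * (1 + |(h : ℝ)|) ^ Cw * (L : ℝ) ^ Cw * (x : ℝ) ^ (1 - δ₀) :=
    fun x L hL h hh => HWL q (b₀ % q) hq hb₁q x L hL h hh
  -- the constant
  set K₃ : ℝ := 1872 * (2 : ℝ) ^ Cw * KW' with hK₃
  have hK₃0 : 0 ≤ K₃ := by rw [hK₃]; positivity
  have hy1n : 1 ≤ y := le_trans (le_max_right _ _) hy
  have hy1 : (1 : ℝ) ≤ y := by exact_mod_cast hy1n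
  have hy0 : (0 : ℝ) < y := by linarith
  have hq0 : (0 : ℝ) < q := by exact_mod_cast hq
  have hq1 : (1 : ℝ) ≤ q := by exact_mod_cast hq
  have hb₁y : b₀ % q ≤ y := le_trans hb₁q.le hyq
  have hmul : ∀ u v : ℝ, (y : ℝ) ^ u * (y : ℝ) ^ v = (y : ℝ) ^ (u + v) := fun u v =>
    (Real.rpow_add hy0 u v).symm
  have hrle : ∀ {u v : ℝ}, u ≤ v → (y : ℝ) ^ u ≤ (y : ℝ) ^ v := fun h =>
    Real.rpow_le_rpow_of_exponent_le hy1 h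
  have hrpos : ∀ u : ℝ, 0 < (y : ℝ) ^ u := fun u => Real.rpow_pos_of_pos hy0 u
  -- ## the data of `abs_typeI_le`
  obtain ⟨N₀, hN₀def⟩ : ∃ N : ℕ, N = ⌊(y : ℝ) ^ (1 - 2 * ε)⌋₊ := ⟨_, rfl⟩
  obtain ⟨lb, hlbdef⟩ : ∃ N : ℕ, N = ⌊(y : ℝ) ^ (1 - 7 * ε)⌋₊ := ⟨_, rfl⟩
  obtain ⟨H, hHdef⟩ : ∃ N : ℕ, N = ⌊(y : ℝ) ^ (5 * ε)⌋₊ := ⟨_, rfl⟩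
  have hN₀lo : (y : ℝ) ^ (1 - 2 * ε) / 2 ≤ N₀ := by rw [hN₀def]; exact TypeIFromWeyl.half_le_floor hy2
  have hN₀hi : (N₀ : ℝ) ≤ (y : ℝ) ^ (1 - 2 * ε) := by rw [hN₀def]; exact Nat.floor_le (by positivity)
  have hlblo : (y : ℝ) ^ (1 - 7 * ε) / 2 ≤ lb := by rw [hlbdef]; exact TypeIFromWeyl.half_le_floor hy3
  have hlbhi : (lb : ℝ) ≤ (y : ℝ) ^ (1 - 7 * ε) := by rw [hlbdef]; exact Nat.floor_le (by positivity)
  have hHhi : (H : ℝ) ≤ (y : ℝ) ^ (5 * ε) := by rw [hHdef]; exact Nat.floor_le (by positivity)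
  have hH1lo : (y : ℝ) ^ (5 * ε) ≤ (H : ℝ) + 1 := by
    rw [hHdef]; exact (Nat.lt_floor_add_one _).le
  have hN₀1 : 1 ≤ N₀ := by
    have : (1 : ℝ) ≤ N₀ := by linarith
    exact_mod_cast this
  have hlb1 : 1 ≤ lb := by
    have : (1 : ℝ) ≤ lb := by linarith
    exact_mod_cast this
  have hN₀pos : (0 : ℝ) < N₀ := by exact_mod_cast hN₀1
  have hlbpos : (0 : ℝ) < lb := by exact_mod_cast hlb1
  have hH16 : (16 : ℝ) ≤ (H : ℝ) + 1 := hy4.trans hH1lo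
  -- `δ' = 1/√(H+1)`
  have hsq : 4 ≤ Real.sqrt ((H : ℝ) + 1) := by
    rw [show (4 : ℝ) = Real.sqrt 16 by rw [show (16 : ℝ) = 4 ^ 2 by norm_num, Real.sqrt_sq (by norm_num)]]
    exact Real.sqrt_le_sqrt hH16
  have hsqpos : 0 < Real.sqrt ((H : ℝ) + 1) := by linarith
  have hδ'0 : 0 < 1 / Real.sqrt ((H : ℝ) + 1) := by positivity
  have hδ'4 : 1 / Real.sqrt ((H : ℝ) + 1) ≤ 1 / 4 := one_div_le_one_div_of_le (by norm_num) hsq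
  have hHδ : 1 ≤ ((H : ℝ) + 1) * (1 / Real.sqrt ((H : ℝ) + 1)) := by
    rw [mul_one_div, le_div_iff₀ hsqpos, one_mul]
    have hs1 : (1 : ℝ) ≤ Real.sqrt ((H : ℝ) + 1) := by linarith
    have hss : Real.sqrt ((H : ℝ) + 1) * Real.sqrt ((H : ℝ) + 1) = (H : ℝ) + 1 :=
      Real.mul_self_sqrt (by positivity)
    calc Real.sqrt ((H : ℝ) + 1) = Real.sqrt ((H : ℝ) + 1) * 1 := (mul_one _).symm
      _ ≤ Real.sqrt ((H : ℝ) + 1) * Real.sqrt ((H : ℝ) + 1) :=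
          mul_le_mul_of_nonneg_left hs1 hsqpos.le
      _ = (H : ℝ) + 1 := hss
  -- `Y`, `S`, the roots, `Φ`
  have hY0 : 0 < (y : ℝ) / q := div_pos hy0 hq0
  obtain ⟨R, hR⟩ : ∃ R : ℕ → Finset ℕ, R = fun n => if n.Coprime (q * B) then
    TypeIFromWeyl.rootSet (P.comp (C (q : ℤ) * X + C ((b₀ % q : ℕ) : ℤ))) n else ∅ := ⟨_, rfl⟩
  have hRcop : ∀ n : ℕ, n.Coprime (q * B) →
      R n = TypeIFromWeyl.rootSet (P.comp (C (q : ℤ) * X + C ((b₀ % q : ℕ) : ℤ))) n := fun n hn => by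
    rw [hR]; dsimp only; rw [if_pos hn]
  obtain ⟨Φ, hΦdef⟩ : ∃ F : ℝ, F = 2 * KW' *
      (1 + (H : ℝ)) ^ Cw * (ℓ : ℝ) ^ Cw * (N₂ : ℝ) ^ (1 - δ₀) := ⟨_, rfl⟩
  have hΦ0 : 0 ≤ Φ := by rw [hΦdef]; positivity
  -- ## the abstract bound
  have habs := TypeIFromWeyl.abs_typeI_le R (fun n => ℓ ∣ n ∧ n.Coprime (q * B)) (S := (2 * (y : ℝ) - (b₀ % q : ℕ)) / q)
    hY0 hN12 hlb1 hN₀1 (H := H) hδ'0 hδ'4 hHδ hΦ0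
    (fun k => by rw [hR]; exact hρsum q (b₀ % q) (q * B) hqQ hcQ k)
    (by
      intro d hd hdH k₁ k₂ hk₁ hk12 hk₂
      have hsum : ∑ n ∈ (Finset.Ioc k₁ k₂).filter (fun n => ℓ ∣ n ∧ n.Coprime (q * B)), TypeIFromWeyl.weylC R n d =
          ∑ n ∈ (Finset.Ioc k₁ k₂).filter (fun n => ℓ ∣ n ∧ n.Coprime (q * B)),
            polyRootWeylSum (P.comp (C (q : ℤ) * X + C ((b₀ % q : ℕ) : ℤ))) n (-d) := by
        refine Finset.sum_congr rfl fun n hn => ?_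
        rw [Finset.mem_filter] at hn
        rw [TypeIFromWeyl.weylC_congr (hRcop n hn.2.2), TypeIFromWeyl.weylC_rootSet]
      rw [hsum, TypeIFromWeyl.sum_Ioc_filter_eq_sub (fun n => ℓ ∣ n ∧ n.Coprime (q * B)) hk12]
      have hpre : ∀ k : ℕ, k ≤ N₂ →
          ‖∑ n ∈ (Finset.Icc 1 k).filter (fun n => ℓ ∣ n ∧ n.Coprime (q * B)),
            polyRootWeylSum (P.comp (C (q : ℤ) * X + C ((b₀ % q : ℕ) : ℤ))) n (-d)‖ ≤ Φ / 2 := by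
        intro k hk
        refine (hWL k ℓ hℓ (-d) (neg_ne_zero.mpr hd)).trans ?_
        rw [hΦdef]
        have h1 : (1 + |((-d : ℤ) : ℝ)|) ^ Cw ≤ (1 + (H : ℝ)) ^ Cw := by
          refine Real.rpow_le_rpow (by positivity) ?_ hC
          push_cast; rw [abs_neg]
          have : |(d : ℝ)| ≤ H := by rw [← Int.cast_abs]; exact_mod_cast hdH
          linarith
        have h2 : (k : ℝ) ^ (1 - δ₀) ≤ (N₂ : ℝ) ^ (1 - δ₀) :=
          Real.rpow_le_rpow (Nat.cast_nonneg _) (by exact_mod_cast hk) (by linarith)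
        calc KW' * (1 + |((-d : ℤ) : ℝ)|) ^ Cw * (ℓ : ℝ) ^ Cw * (k : ℝ) ^ (1 - δ₀)
            ≤ KW' * (1 + (H : ℝ)) ^ Cw * (ℓ : ℝ) ^ Cw * (k : ℝ) ^ (1 - δ₀) := by
              apply mul_le_mul_of_nonneg_right _ (by positivity)
              apply mul_le_mul_of_nonneg_right _ (by positivity)
              exact mul_le_mul_of_nonneg_left h1 hKW0
          _ ≤ KW' * (1 + (H : ℝ)) ^ Cw * (ℓ : ℝ) ^ Cw * (N₂ : ℝ) ^ (1 - δ₀) := by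
              apply mul_le_mul_of_nonneg_left h2; positivity
          _ = _ := by ring
      calc _ ≤ Φ / 2 + Φ / 2 := (norm_sub_le _ _).trans (add_le_add (hpre k₂ hk₂) (hpre k₁ (hk12.trans hk₂)))
        _ = Φ := by ring)
  -- ## the left-hand side is the sum of the discrepancies
  have hlhs : ∑ n ∈ (Finset.Ioc N₁ N₂).filter (fun n => ℓ ∣ n ∧ n.Coprime (q * B)),
      ((((Finset.Ioc y (2 * y)).filter (fun t : ℕ => t % q = b₀ % q ∧
          (n : ℤ) ∣ P.eval (t : ℤ))).card : ℝ) -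
        (y : ℝ) / q * (polyRootCountMod ![P] n : ℝ) / n) =
      ∑ n ∈ (Finset.Ioc N₁ N₂).filter (fun n => ℓ ∣ n ∧ n.Coprime (q * B)),
        TypeIFromWeyl.disc R ((2 * (y : ℝ) - (b₀ % q : ℕ)) / q) ((y : ℝ) / q) n := by
    refine Finset.sum_congr rfl fun n hn => ?_
    rw [Finset.mem_filter, Finset.mem_Ioc] at hn
    have hn1 : 0 < n := by omega
    have hcop := hn.2.2
    have hqn : q.Coprime n := Nat.coprime_of_dvd fun p hp hpq hpn =>
      (Nat.Prime.coprime_iff_not_dvd hp).mp (Nat.Coprime.coprime_dvd_left hpn hcop) (hqQ p hp hpq)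
    unfold TypeIFromWeyl.disc
    rw [TypeIFromWeyl.countA_congr (hRcop n hcop), hRcop n hcop]
    have hcount := TypeIFromWeyl.card_progression_eq P hq hb₁q hb₁y hn1
    have hcount' : ((((Finset.Ioc y (2 * y)).filter (fun t : ℕ => t % q = b₀ % q ∧
        (n : ℤ) ∣ P.eval (t : ℤ))).card : ℕ) : ℝ) =
        ((TypeIFromWeyl.countA (TypeIFromWeyl.rootSet (P.comp (C (q : ℤ) * X + C ((b₀ % q : ℕ) : ℤ))))
          ((2 * (y : ℝ) - (b₀ % q : ℕ)) / q) ((y : ℝ) / q) n : ℤ) : ℝ) := by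
      unfold TypeIFromWeyl.countA
      exact_mod_cast hcount
    rw [hcount', TypeIFromWeyl.card_rootSet_comp_eq P hn1 hqn, TypeIFromWeyl.card_rootSet]
    ring
  rw [hlhs]
  refine habs.trans ?_
  -- ## numerics: every term is `≪ y^{1−ε}`
  have hss : Real.sqrt ((H : ℝ) + 1) * Real.sqrt ((H : ℝ) + 1) = (H : ℝ) + 1 :=
    Real.mul_self_sqrt (by positivity)
  have hYle : (y : ℝ) / q ≤ y := div_le_self hy0.le hq1
  have hSabs : |(2 * (y : ℝ) - (b₀ % q : ℕ)) / q| ≤ 2 * y := by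
    have hb0 : (0 : ℝ) ≤ (b₀ % q : ℕ) := Nat.cast_nonneg _
    have hby : ((b₀ % q : ℕ) : ℝ) ≤ y := by exact_mod_cast hb₁y
    rw [abs_of_nonneg (div_nonneg (by linarith) hq0.le)]
    calc (2 * (y : ℝ) - (b₀ % q : ℕ)) / q ≤ (2 * (y : ℝ) - (b₀ % q : ℕ)) / 1 :=
          div_le_div_of_nonneg_left (by linarith) one_pos hq1
      _ ≤ 2 * y := by rw [div_one]; linarith
  -- powers of `y`
  have ha2 : ((y : ℝ) ^ (1 - 2 * ε)) ^ 2 = (y : ℝ) ^ (2 - 4 * ε) := by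
    rw [sq, hmul]; congr 1; ring
  have hN₀sq : (y : ℝ) ^ (2 - 4 * ε) / 4 ≤ (N₀ : ℝ) ^ 2 := by
    have h := pow_le_pow_left₀ (by positivity) hN₀lo 2
    rw [div_pow, ha2] at h
    norm_num at h
    linarith
  have hN₀sq0 : (0 : ℝ) < (N₀ : ℝ) ^ 2 := by positivity
  have hyb : (y : ℝ) * (y : ℝ) ^ (1 - 7 * ε) = (y : ℝ) ^ (2 - 7 * ε) := by
    rw [show (2 : ℝ) - 7 * ε = 1 + (1 - 7 * ε) by ring, Real.rpow_add hy0, Real.rpow_one]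
  have hratio : (y : ℝ) * (y : ℝ) ^ (1 - 7 * ε) / ((y : ℝ) ^ (2 - 4 * ε) / 4) =
      4 * (y : ℝ) ^ (-(3 * ε)) := by
    have hd : (y : ℝ) ^ (2 - 7 * ε) / (y : ℝ) ^ (2 - 4 * ε) = (y : ℝ) ^ (-(3 * ε)) := by
      rw [← Real.rpow_sub hy0]; congr 1; ring
    rw [hyb, ← hd]
    field_simp
  -- (T1)
  have hT1 : Cρ * (N₀ : ℝ) ≤ Cρ * (y : ℝ) ^ (1 - ε) :=
    mul_le_mul_of_nonneg_left (hN₀hi.trans (hrle (by linarith))) hCρ.le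
  -- (T2)
  have hcoef1 : (y : ℝ) / q * lb / (N₀ : ℝ) ^ 2 ≤ 4 * (y : ℝ) ^ (-(3 * ε)) := by
    rw [← hratio]
    have hnum : (y : ℝ) / q * lb ≤ (y : ℝ) * (y : ℝ) ^ (1 - 7 * ε) :=
      mul_le_mul hYle hlbhi hlbpos.le hy0.le
    exact div_le_div₀ (by positivity) hnum (by positivity) hN₀sq
  have hsqc : (y : ℝ) ^ (5 * ε / 2) ≤ Real.sqrt ((H : ℝ) + 1) := by
    have : Real.sqrt ((y : ℝ) ^ (5 * ε)) = (y : ℝ) ^ (5 * ε / 2) := by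
      rw [Real.sqrt_eq_rpow, ← Real.rpow_mul hy0.le]; congr 1; ring
    rw [← this]; exact Real.sqrt_le_sqrt hH1lo
  have hfej : 2 * (1 / Real.sqrt ((H : ℝ) + 1)) + 2 / (((H : ℝ) + 1) * (1 / Real.sqrt ((H : ℝ) + 1))) ≤
      4 * (y : ℝ) ^ (-(5 * ε / 2)) := by
    have h1 : ((H : ℝ) + 1) * (1 / Real.sqrt ((H : ℝ) + 1)) = Real.sqrt ((H : ℝ) + 1) := by
      rw [mul_one_div, div_eq_iff hsqpos.ne', hss]
    rw [h1, Real.rpow_neg hy0.le]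
    have h2 : 1 / Real.sqrt ((H : ℝ) + 1) ≤ 1 / (y : ℝ) ^ (5 * ε / 2) :=
      one_div_le_one_div_of_le (hrpos _) hsqc
    have h3 : 2 / Real.sqrt ((H : ℝ) + 1) = 2 * (1 / Real.sqrt ((H : ℝ) + 1)) := by ring
    rw [h3, ← one_div]
    linarith
  have hcoef : (y : ℝ) / q * lb / (N₀ : ℝ) ^ 2 + 2 * (1 / Real.sqrt ((H : ℝ) + 1)) +
      2 / (((H : ℝ) + 1) * (1 / Real.sqrt ((H : ℝ) + 1))) ≤ 8 * (y : ℝ) ^ (-(5 * ε / 2)) := by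
    have : (y : ℝ) ^ (-(3 * ε)) ≤ (y : ℝ) ^ (-(5 * ε / 2)) := hrle (by linarith)
    linarith
  have hT2 : ((y : ℝ) / q * lb / (N₀ : ℝ) ^ 2 + 2 * (1 / Real.sqrt ((H : ℝ) + 1)) +
      2 / (((H : ℝ) + 1) * (1 / Real.sqrt ((H : ℝ) + 1)))) * (Cρ * N₂) ≤
      8 * Cρ * (y : ℝ) ^ (1 - ε) := by
    have hN₂' : Cρ * (N₂ : ℝ) ≤ Cρ * (y : ℝ) ^ (1 + ε) := mul_le_mul_of_nonneg_left hN₂ hCρ.le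
    calc _ ≤ 8 * (y : ℝ) ^ (-(5 * ε / 2)) * (Cρ * (y : ℝ) ^ (1 + ε)) :=
          mul_le_mul hcoef hN₂' (by positivity) (by positivity)
      _ = 8 * Cρ * ((y : ℝ) ^ (-(5 * ε / 2)) * (y : ℝ) ^ (1 + ε)) := by ring
      _ ≤ 8 * Cρ * (y : ℝ) ^ (1 - ε) := by
          apply mul_le_mul_of_nonneg_left _ (by positivity)
          rw [hmul]; exact hrle (by linarith)
  -- (T3)
  have hX1 : (N₂ : ℝ) / lb + 1 ≤ 3 * (y : ℝ) ^ (8 * ε) := by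
    have h1 : (N₂ : ℝ) / lb ≤ (y : ℝ) ^ (1 + ε) / ((y : ℝ) ^ (1 - 7 * ε) / 2) :=
      div_le_div₀ (by positivity) hN₂ (by positivity) hlblo
    have h2 : (y : ℝ) ^ (1 + ε) / ((y : ℝ) ^ (1 - 7 * ε) / 2) = 2 * (y : ℝ) ^ (8 * ε) := by
      have hd : (y : ℝ) ^ (1 + ε) / (y : ℝ) ^ (1 - 7 * ε) = (y : ℝ) ^ (8 * ε) := by
        rw [← Real.rpow_sub hy0]; congr 1; ring
      rw [← hd]
      field_simp
    have h3 : (1 : ℝ) ≤ (y : ℝ) ^ (8 * ε) := Real.one_le_rpow hy1 (by positivity)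
    linarith
  have hX2 : (y : ℝ) / q / N₀ + 1 ≤ 3 * (y : ℝ) ^ (2 * ε) := by
    have h1 : (y : ℝ) / q / N₀ ≤ (y : ℝ) / ((y : ℝ) ^ (1 - 2 * ε) / 2) :=
      div_le_div₀ hy0.le hYle (by positivity) hN₀lo
    have h2 : (y : ℝ) / ((y : ℝ) ^ (1 - 2 * ε) / 2) = 2 * (y : ℝ) ^ (2 * ε) := by
      have hd : (y : ℝ) / (y : ℝ) ^ (1 - 2 * ε) = (y : ℝ) ^ (2 * ε) := by
        rw [div_eq_iff (hrpos _).ne', hmul, show 2 * ε + (1 - 2 * ε) = (1 : ℝ) by ring,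
          Real.rpow_one]
      rw [← hd]
      field_simp
    have h3 : (1 : ℝ) ≤ (y : ℝ) ^ (2 * ε) := Real.one_le_rpow hy1 (by positivity)
    linarith
  have hX3 : 2 * (H : ℝ) ≤ 2 * (y : ℝ) ^ (5 * ε) := by linarith
  have hX4 : 1 + 2 * Real.pi * |(2 * (y : ℝ) - (b₀ % q : ℕ)) / q| * lb / (N₀ : ℝ) ^ 2 ≤ 52 := by
    have h1 : 2 * Real.pi * |(2 * (y : ℝ) - (b₀ % q : ℕ)) / q| * lb / (N₀ : ℝ) ^ 2 ≤
        2 * Real.pi * (2 * y) * (y : ℝ) ^ (1 - 7 * ε) / ((y : ℝ) ^ (2 - 4 * ε) / 4) := by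
      refine div_le_div₀ (by positivity) ?_ (by positivity) hN₀sq
      exact mul_le_mul (mul_le_mul_of_nonneg_left hSabs (by positivity)) hlbhi hlbpos.le
        (by positivity)
    have h2 : 2 * Real.pi * (2 * y) * (y : ℝ) ^ (1 - 7 * ε) / ((y : ℝ) ^ (2 - 4 * ε) / 4) =
        4 * Real.pi * (4 * (y : ℝ) ^ (-(3 * ε))) := by
      rw [← hratio]; ring
    have h3 : (y : ℝ) ^ (-(3 * ε)) ≤ 1 := Real.rpow_le_one_of_one_le_of_nonpos hy1 (by linarith)
    have h4 := Real.pi_lt_d2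
    nlinarith [Real.pi_pos]
  have hcy : (1 : ℝ) ≤ (y : ℝ) ^ (5 * ε) := Real.one_le_rpow hy1 (by positivity)
  have hX5 : Φ ≤ 2 * KW' * (2 : ℝ) ^ Cw *
      ((y : ℝ) ^ (5 * ε * Cw) * (y : ℝ) ^ (ε * Cw) * (y : ℝ) ^ ((1 + ε) * (1 - δ₀))) := by
    rw [hΦdef]
    have h1 : (1 + (H : ℝ)) ^ Cw ≤ (2 : ℝ) ^ Cw * (y : ℝ) ^ (5 * ε * Cw) := by
      rw [Real.rpow_mul hy0.le, ← Real.mul_rpow (by norm_num) (by positivity)]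
      exact Real.rpow_le_rpow (by positivity) (by linarith) hC
    have h2 : (ℓ : ℝ) ^ Cw ≤ (y : ℝ) ^ (ε * Cw) := by
      rw [Real.rpow_mul hy0.le]
      exact Real.rpow_le_rpow (by positivity) hℓy hC
    have h3 : (N₂ : ℝ) ^ (1 - δ₀) ≤ (y : ℝ) ^ ((1 + ε) * (1 - δ₀)) := by
      rw [Real.rpow_mul hy0.le]
      exact Real.rpow_le_rpow (Nat.cast_nonneg _) hN₂ (by linarith)
    have h0 : 0 ≤ 2 * KW' := by positivity
    calc 2 * KW' * (1 + (H : ℝ)) ^ Cw * (ℓ : ℝ) ^ Cw * (N₂ : ℝ) ^ (1 - δ₀)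
        = 2 * KW' * ((1 + (H : ℝ)) ^ Cw * (ℓ : ℝ) ^ Cw * (N₂ : ℝ) ^ (1 - δ₀)) := by ring
      _ ≤ 2 * KW' * (((2 : ℝ) ^ Cw * (y : ℝ) ^ (5 * ε * Cw)) *
          (y : ℝ) ^ (ε * Cw) * (y : ℝ) ^ ((1 + ε) * (1 - δ₀))) := by
          apply mul_le_mul_of_nonneg_left _ h0
          exact mul_le_mul (mul_le_mul h1 h2 (by positivity) (by positivity)) h3 (by positivity)
            (by positivity)
      _ = _ := by ring
  have hE : (y : ℝ) ^ (8 * ε) * (y : ℝ) ^ (2 * ε) * (y : ℝ) ^ (5 * ε) *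
      ((y : ℝ) ^ (5 * ε * Cw) * (y : ℝ) ^ (ε * Cw) * (y : ℝ) ^ ((1 + ε) * (1 - δ₀))) ≤
      (y : ℝ) ^ (1 - ε) := by
    rw [hmul, hmul, hmul, hmul, hmul]
    refine hrle ?_
    have h1 : 0 ≤ ε * δ₀ := by positivity
    nlinarith
  have hT3 : ((N₂ : ℝ) / lb + 1) * ((y : ℝ) / q / N₀ + 1) *
      (2 * (H : ℝ) * (1 + 2 * Real.pi * |(2 * (y : ℝ) - (b₀ % q : ℕ)) / q| * lb / (N₀ : ℝ) ^ 2) * Φ) ≤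
      K₃ * (y : ℝ) ^ (1 - ε) := by
    have hA : ((N₂ : ℝ) / lb + 1) * ((y : ℝ) / q / N₀ + 1) ≤
        (3 * (y : ℝ) ^ (8 * ε)) * (3 * (y : ℝ) ^ (2 * ε)) :=
      mul_le_mul hX1 hX2 (by positivity) (by positivity)
    have hB : 2 * (H : ℝ) * (1 + 2 * Real.pi * |(2 * (y : ℝ) - (b₀ % q : ℕ)) / q| * lb / (N₀ : ℝ) ^ 2) * Φ ≤
        (2 * (y : ℝ) ^ (5 * ε)) * 52 * (2 * KW' * (2 : ℝ) ^ Cw *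
          ((y : ℝ) ^ (5 * ε * Cw) * (y : ℝ) ^ (ε * Cw) * (y : ℝ) ^ ((1 + ε) * (1 - δ₀)))) :=
      mul_le_mul (mul_le_mul hX3 hX4 (by positivity) (by positivity)) hX5 hΦ0 (by positivity)
    calc _ ≤ (3 * (y : ℝ) ^ (8 * ε)) * (3 * (y : ℝ) ^ (2 * ε)) *
          ((2 * (y : ℝ) ^ (5 * ε)) * 52 * (2 * KW' * (2 : ℝ) ^ Cw *
            ((y : ℝ) ^ (5 * ε * Cw) * (y : ℝ) ^ (ε * Cw) * (y : ℝ) ^ ((1 + ε) * (1 - δ₀))))) :=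
          mul_le_mul hA hB (by positivity) (by positivity)
      _ = K₃ * ((y : ℝ) ^ (8 * ε) * (y : ℝ) ^ (2 * ε) * (y : ℝ) ^ (5 * ε) *
          ((y : ℝ) ^ (5 * ε * Cw) * (y : ℝ) ^ (ε * Cw) * (y : ℝ) ^ ((1 + ε) * (1 - δ₀)))) := by
          rw [hK₃]; ring
      _ ≤ K₃ * (y : ℝ) ^ (1 - ε) := mul_le_mul_of_nonneg_left hE hK₃0
  have hfinal := add_le_add (add_le_add hT1 hT2) hT3
  refine hfinal.trans ?_
  have hqA : (1 : ℝ) ≤ (q : ℝ) ^ Aq := Real.one_le_rpow hq1 hAq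
  have h9 : 9 * Cρ * (y : ℝ) ^ (1 - ε) ≤ 9 * Cρ * (q : ℝ) ^ Aq * (y : ℝ) ^ (1 - ε) := by
    have : 9 * Cρ * (y : ℝ) ^ (1 - ε) * 1 ≤ 9 * Cρ * (y : ℝ) ^ (1 - ε) * (q : ℝ) ^ Aq :=
      mul_le_mul_of_nonneg_left hqA (by positivity)
    linarith
  calc Cρ * (y : ℝ) ^ (1 - ε) + 8 * Cρ * (y : ℝ) ^ (1 - ε) + K₃ * (y : ℝ) ^ (1 - ε)
      = 9 * Cρ * (y : ℝ) ^ (1 - ε) + K₃ * (y : ℝ) ^ (1 - ε) := by ring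
    _ ≤ 9 * Cρ * (q : ℝ) ^ Aq * (y : ℝ) ^ (1 - ε) + K₃ * (y : ℝ) ^ (1 - ε) := by linarith
    _ = (9 * Cρ + 1872 * (2 : ℝ) ^ Cw * Kw) * (q : ℝ) ^ Aq * (y : ℝ) ^ (1 - ε) := by
        rw [hK₃, hKW']; ring


end TypeIUniform

end Literature.NumberTheory.Sieve
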